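import Literature.Barriers.CriticalPhenomena.LongRangeTrivialityOnZ3InfraredBoundLowDim
import Literature.Barriers.CriticalPhenomena.LongRangeTrivialityOnZ3InfraredBoundKernel
import Literature.Barriers.CriticalPhenomena.LongRangeTrivialityOnZ3TorusLimit
import Mathlib.Analysis.Normed.Group.Tannery

/-!
# Panis 2023, Proposition 3.7 (the infrared bound in infinite volume below `β_c`) with the
# Fröhlich–Simon–Spencer constant: DISCHARGE of `panis_prop37_infraredBound_fss`

Sibling of `Literature/Barriers/CriticalPhenomena/LongRangeTrivialityOnZ3InfraredBoundLowDim.lean`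
(barrier catalogue D-0021, sub-problem `Ising3DConformalLimit`), which vendors the named fact
`Literature.Barriers.CriticalPhenomena.panis_prop37_infraredBound_fss`: for `J_{x,y} = C₀|x-y|₁^{-d-α}`
(`d ≥ 1`, `C₀, α > 0`), `0 < β < β_c`, `p ∈ (-π,π]^d ∖ {0}`,
`Ŝ_β(p) = ∑_x S_β(x)cos(p·x) ≤ 1/(β|J|(1 - Ĵ(p)))` (R. Panis, *Triviality of the scaling limits of
critical Ising and `φ⁴` models with effective dimension at least four*, arXiv:2309.05797 = Ann. Probab. 54
(2026), Proposition 3.7, with the Gaussian-domination constant of Fröhlich–Simon–Spencer /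
Friedli–Velenik Thm. 10.24 in place of the printed `1/(2β|J|(1-Ĵ))`, see the module docstring of
`…InfraredBoundLowDim`). This file proves `theorem panis_prop37_infraredBound_fss_holds`.

## The proof

The printed proof (p. 14 of the TeX-derived text): Proposition 3.4 (the torus infrared bound, Gaussian
domination — the tree's `torus_twoPointFourier_le`, `…TorusRP`), the convergence
`⟨τ₀τ_x⟩_{𝕋_L} → ⟨τ₀τ_x⟩` below `β_c` (uniqueness of the state — the tree's
`abs_torusPair_sub_pairCorrelation_le`, `…TorusLimit`, from `m*(β) = 0`), Fatou on the nonnegative sum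
`∑_x(1 + cos p·x)S(x)`, and `χ^{(L)} → χ` by the Simon–Lieb inequality and the finiteness of `χ` below
`β_c` [ABF]. The last two inputs are not in the tree for long-range interactions
(`abf_pairCorrelation_summable` is an unproved named fact), so the zero mode is AVOIDED: instead of the
full-torus weight `1 + cos p·x` we test against a MODULATED JACKSON WINDOW localised in `x`-space,
`f(x) = g_L(x)e^{-ip·x}`, `g_L = 𝟙_{Λ_L} ⋆ 𝟙_{Λ_L}`, whose Fourier transform `‖W_k‖⁴`,
`W_k = ∑_{u∈Λ_L}e^{i(θ_k-p)·u}` (a product of fourth powers of Dirichlet kernels) concentrates at `p`.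

1. `fourfold_parseval` — Parseval on `𝕋_N` with complex weights (`sum_sum_weight_kernel_eq_fourier`,
   extending the multiplicity version of `…InfraredBoundHolds`): for a real kernel `G` and a finite
   `T ⊂ ℤ^d`, `∑_{u,v,u',v'∈T} cos(p·m)G(m̄) = N^{-d}∑_k Ŝ(k)‖W_k(T)‖⁴`, `m = u-v-u'+v'`,
   `Ŝ(k) = ∑_zG(z)Re χ_k(z)`; with `G = δ₀`, `N^{-d}∑_k‖W_k(T)‖⁴ = c_T(0)`, the fourfold count
   `c_T(m) = #{(u,v,u',v') ∈ T⁴ : u-v-u'+v' = m}` (`quadCount`; for boxes it factorises,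
   `quadCount_abox`, with `c¹_L(t)/c¹_L(0) → 1`, `c_{Λ_L}(m) ≤ 27^d c_{Λ_L}(0)`, `c_{Λ_L}(0) ≥ L^{3d}`);
2. `torusFourierRe_twoPoint_nonneg` — `Ŝ_N(k) = N^{-d}⟨|∑_aχ_k(a)σ_a|²⟩ ≥ 0` (Panis: "`Ŝ^{(L)}(p) ≥ 0`");
3. `fourierSide_le` — the THREE-REGION BOUND at finite even `N`: near momenta (every coordinate of
   `θ_k - p` within `δ` of `2πℤ`): `θ_k ≡ p + η` (`exists_eta_of_isNear`), `Ĵ(θ_k) = Ĵ(p+η)`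
   (`couplingFourier_add_two_pi_mul`), and the torus infrared bound gives `Ŝ_N(k) ≤ B(p) + ω` by continuity;
   far momenta off the small cube `‖θ‖_∞ < r = |p_{i₀}|/2`: `Ŝ_N ≤ 1/(β|J|c₁r²)` (cube gap bound
   `1 - Ĵ(q) ≥ c₁‖q‖²`) and one Dirichlet factor is `≤ 1/sin(δ/2)` (`norm_dirichletKernel_le_of_far`), the
   remaining partial kernel having total mass `N^dc_{slab}(0) ≤ N^d(2L+1)^{3(d-1)}`; the small cube: the
   coordinate `i₀` (`|p_{i₀}| = ‖p‖_∞ > 0`) is far, `Ŝ_N ≥ 0` lets one extend the sum to all `k`, and the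
   slab Parseval identity turns it back into `x`-space: `≤ C'(2L+1)^{3(d-1)}∑_{m∈Λ_{4L}}G_N(m̄)`;
4. `exists_singleBoxSum_package` — the single box sum `∑_{m∈Λ_{4L}}G_N(m̄)` is `≤ |Λ_{4L}|` trivially
   (enough for `d ≤ 2`, the cases of Remark 3.9 where `1/(1-Ĵ)` need not be integrable and nothing else
   is available) and, for `d ≥ 3`, `≤ o(1) + C_K(8L)^{α∧2}` by the `x`-space torus bound
   `torus_sum_sum_box_le` (`…InfraredBoundHolds`) and the vanishing of the torus zero mode below `β_c`
   (`torus_zeroMode_le_eventually`, `…TorusZeroMode`); in both cases `≤ D L^e` with `e < 3`;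
5. `fourfoldFree_le` — `N → ∞` along the even tori `𝕋_{2M+2}` by `abs_torusPair_sub_pairCorrelation_le`:
   `∑_{Λ_L⁴}cos(p·m)S_β(m) ≤ (B(p)+ω)c_{Λ_L}(0) + O((2L+1)^{3(d-1)}(1 + L^e))`;
6. `tendsto_fourfoldFree_div` — `c_{Λ_L}(0)⁻¹∑_{Λ_L⁴}cos(p·m)S_β(m) = ∑_m(c_L(m)/c_L(0))S_β(m)cos(p·m)
   → Ŝ_β(p)` when `x ↦ S_β(x)cos(p·x)` is summable (dominated convergence, Tannery), the error terms being
   `O(L^{e-3}) → 0` (`tendsto_error_div_quadCount`); if it is not summable the `tsum` is `0` and the bound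
   is trivial; finally `ω → 0`.

No named fact is introduced; `abf_pairCorrelation_summable` and the printed-constant
`panis_prop37_infraredBound` are not used. All four infrared facts of `…InfraredBoundLowDim`
(`panis_infraredBound_algebraic_lowDim_of_prop37`, …) thereby hold with the single remaining input
`abf_pairCorrelation_summable`.

## References

* R. Panis, arXiv:2309.05797 (2023) = Ann. Probab. 54 (2026), §3.3: Prop. 3.4, Remark 3.5, the
  definition of `Ŝ_{ρ,β}` and "`Ŝ^{(L)}(p) ≥ 0`", Prop. 3.7 and its proof, Remark 3.9
  [Panis2023Triviality] (held as TeX-derived text `paper:arxiv-2309.05797`, pp. 13–15 read).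
* S. Friedli, Y. Velenik, *Statistical Mechanics of Lattice Systems*, CUP (2017), Thm. 10.24 (p. 502)
  with (10.38) (p. 499) (the Gaussian-domination constant) [FriedliVelenik2017] (held).
* J. Fröhlich, B. Simon, T. Spencer, CMP 50 (1976), §3 (the Fourier-space quadratic form)
  [FrohlichSimonSpencer1976] (cited through the tree's `…InfraredBoundHolds`).
* Mathlib: `tendsto_tsum_of_dominated_convergence` (Tannery), `AddChar`/`ZMod.dft` through the tree's
  `TorusFourierProofs` (`sum_sum_mul_torusFourierInv`, `torusFourier_inversion_holds`).
-/

noncomputable section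

namespace Literature.Barriers.CriticalPhenomena

open Literature.Probability.LatticeModels Literature.Probability.Percolation Filter Topology Finset
open _root_.MeasureTheory Complex
open scoped symmDiff Real ComplexConjugate

namespace LongRangeIsing

variable {d : ℕ}

/-! ### Phases -/

section Phase

/-- `p·(x - y) = p·x - p·y`. [folklore] -/
theorem phase_sub (p : Fin d → ℝ) (x y : Site d) : phase p (x - y) = phase p x - phase p y := by
  have h := phase_add p (x - y) y
  rw [sub_add_cancel] at h
  linarith

/-- `(θ - p)·x = θ·x - p·x`. [folklore] -/
theorem phase_sub_left (θ p : Fin d → ℝ) (x : Site d) : phase (θ - p) x = phase θ x - phase p x := by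
  simp only [phase, Pi.sub_apply, sub_mul, Finset.sum_sub_distrib]

/-- `conj e^{iφ} = e^{-iφ}` for a real phase. [folklore] -/
theorem conj_cexp_I_mul (φ : ℝ) : conj (Complex.exp (Complex.I * (φ : ℂ))) = Complex.exp (-(Complex.I * (φ : ℂ))) := by
  rw [← Complex.exp_conj, map_mul, Complex.conj_I, Complex.conj_ofReal, neg_mul]

/-- `conj e^{-iφ} = e^{iφ}` for a real phase. [folklore] -/
theorem conj_cexp_neg_I_mul (φ : ℝ) : conj (Complex.exp (-(Complex.I * (φ : ℂ)))) = Complex.exp (Complex.I * (φ : ℂ)) := by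
  rw [← Complex.exp_conj, map_neg, map_mul, Complex.conj_I, Complex.conj_ofReal, neg_mul, neg_neg]

/-- `Re e^{iφ} = cos φ`. [folklore] -/
theorem cexp_I_mul_re (φ : ℝ) : (Complex.exp (Complex.I * (φ : ℂ))).re = Real.cos φ := by
  rw [mul_comm, Complex.exp_ofReal_mul_I_re]

end Phase

/-! ### Parseval on the torus with complex weights -/

section WeightedParseval

variable {N : ℕ} [NeZero N]

/-- Weighted sums over a finite family of torus sites through the fibres. [folklore] -/
theorem sum_fiber_weight_mul {X : Type*} [DecidableEq X] (S : Finset X) (φ : X → TorusSite d N)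
    (w : X → ℂ) (f : TorusSite d N → ℂ) :
    ∑ a, (∑ x ∈ S.filter (fun x => φ x = a), w x) * f a = ∑ x ∈ S, w x * f (φ x) := by
  rw [← Finset.sum_fiberwise S φ (fun x => w x * f (φ x))]
  refine Finset.sum_congr rfl fun a _ => ?_
  rw [Finset.sum_mul]
  refine Finset.sum_congr rfl fun x hx => ?_
  rw [(Finset.mem_filter.1 hx).2]

/-- **The quadratic form of a real torus kernel at a weighted finite family of sites, in Fourier
variables** (complex weights): `∑_{x,y∈S} w_x conj(w_y) G(φx - φy) =
N^{-d}∑_k 𝓕G(k) · |∑_{x∈S} w_x χ_k(φx)|²`. [cite: FrohlichSimonSpencer1976, §3] -/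
theorem sum_sum_weight_kernel_eq_fourier (G : TorusSite d N → ℝ) {X : Type*} [DecidableEq X] (S : Finset X)
    (φ : X → TorusSite d N) (w : X → ℂ) :
    ∑ x ∈ S, ∑ y ∈ S, w x * conj (w y) * (G (φ x - φ y) : ℂ) =
      ((N : ℂ) ^ d)⁻¹ * ∑ k, torusFourier (fun z => (G z : ℂ)) k *
        ((∑ x ∈ S, w x * torusChar k (φ x)) * conj (∑ x ∈ S, w x * torusChar k (φ x))) := by
  classical
  set v : TorusSite d N → ℂ := fun a => ∑ x ∈ S.filter (fun x => φ x = a), w x with hv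
  have h := sum_sum_mul_torusFourierInv (torusFourier fun z => (G z : ℂ)) v
  have hinv : torusFourierInv (torusFourier fun z => (G z : ℂ)) = fun z => (G z : ℂ) :=
    torusFourier_inversion_holds (fun z => (G z : ℂ))
  rw [hinv] at h
  -- left-hand side
  have hL : ∑ a, ∑ b, v a * conj (v b) * (G (a - b) : ℂ) = ∑ x ∈ S, ∑ y ∈ S, w x * conj (w y) * (G (φ x - φ y) : ℂ) := by
    calc ∑ a, ∑ b, v a * conj (v b) * (G (a - b) : ℂ)
        = ∑ a, v a * ∑ b, conj (v b) * (G (a - b) : ℂ) := by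
          refine Finset.sum_congr rfl fun a _ => ?_
          rw [Finset.mul_sum]
          exact Finset.sum_congr rfl fun b _ => by ring
      _ = ∑ a, v a * ∑ y ∈ S, conj (w y) * (G (a - φ y) : ℂ) := by
          refine Finset.sum_congr rfl fun a _ => ?_
          congr 1
          have := sum_fiber_weight_mul S φ (fun y => conj (w y)) (fun b => (G (a - b) : ℂ))
          rw [← this]
          refine Finset.sum_congr rfl fun b _ => ?_
          rw [hv, map_sum]
      _ = ∑ x ∈ S, w x * ∑ y ∈ S, conj (w y) * (G (φ x - φ y) : ℂ) :=
          sum_fiber_weight_mul S φ w (fun a => ∑ y ∈ S, conj (w y) * (G (a - φ y) : ℂ))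
      _ = ∑ x ∈ S, ∑ y ∈ S, w x * conj (w y) * (G (φ x - φ y) : ℂ) := by
          refine Finset.sum_congr rfl fun x _ => ?_
          rw [Finset.mul_sum]
          exact Finset.sum_congr rfl fun y _ => by ring
  -- right-hand side
  have hR : ∀ k, ∑ a, v a * torusChar k a = ∑ x ∈ S, w x * torusChar k (φ x) := fun k =>
    sum_fiber_weight_mul S φ w (torusChar k)
  rw [hL] at h
  simp_rw [hR] at h
  exact h

end WeightedParseval

/-! ### The fourfold Parseval identity for a modulated autocorrelation window -/

section Fourfold

variable {N : ℕ} [NeZero N]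

/-- The modulated character sum `W_k = ∑_{u∈T} e^{i(θ_k - p)·u}`. [folklore] -/
def modCharSum (N : ℕ) [NeZero N] (T : Finset (Site d)) (p : Fin d → ℝ) (k : TorusSite d N) : ℂ :=
  ∑ u ∈ T, Complex.exp (Complex.I * (phase (centeredMomentum N k - p) u : ℂ))

/-- The torus Fourier coefficients (real form) `Ŝ(k) = ∑_z G(z) Re χ_k(z)` of a real kernel. [folklore] -/
def torusFourierRe (G : TorusSite d N → ℝ) (k : TorusSite d N) : ℝ := ∑ z, G z * (torusChar k z).re

/-- `Re 𝓕G(k) = ∑_z G(z) Re χ_k(z)` for real `G`. [folklore] -/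
theorem torusFourier_ofReal_re (G : TorusSite d N → ℝ) (k : TorusSite d N) :
    (torusFourier (fun z => (G z : ℂ)) k).re = torusFourierRe G k := by
  rw [torusFourier_eq_sum_torusChar, Complex.re_sum, torusFourierRe]
  refine Finset.sum_congr rfl fun z _ => ?_
  rw [Complex.re_ofReal_mul, Complex.conj_re]

/-- The weighted character sum of the modulated pair family is `W_k · conj W_k`. [folklore] -/
theorem sum_pairWeight_torusChar (T : Finset (Site d)) (p : Fin d → ℝ) (k : TorusSite d N) :
    ∑ q ∈ T ×ˢ T, Complex.exp (-(Complex.I * (phase p (q.1 - q.2) : ℂ))) * torusChar k (Torus.proj N (q.1 - q.2)) =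
      modCharSum N T p k * conj (modCharSum N T p k) := by
  rw [modCharSum, map_sum, Finset.sum_mul_sum, Finset.sum_product]
  refine Finset.sum_congr rfl fun u _ => Finset.sum_congr rfl fun v _ => ?_
  rw [torusChar_proj, conj_cexp_I_mul, ← Complex.exp_add, ← Complex.exp_add]
  congr 1
  simp only [phase_sub, phase_sub_left]
  push_cast
  ring

/-- **Fourfold Parseval**: for a real kernel `G` on `𝕋_N`, a finite `T ⊂ ℤ^d` and `p ∈ ℝ^d`,
`∑_{u,v,u',v'∈T} cos(p·m) G(m̄) = N^{-d}∑_k Ŝ(k) ‖W_k‖⁴`, `m = u - v - u' + v'`,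
`W_k = ∑_{u∈T}e^{i(θ_k-p)·u}`. [cite: FrohlichSimonSpencer1976, §3] -/
theorem fourfold_parseval (G : TorusSite d N → ℝ) (T : Finset (Site d)) (p : Fin d → ℝ) :
    ∑ u ∈ T, ∑ v ∈ T, ∑ u' ∈ T, ∑ v' ∈ T,
        Real.cos (phase p (u - v - u' + v')) * G (Torus.proj N (u - v - u' + v')) =
      ((N : ℝ) ^ d)⁻¹ * ∑ k, torusFourierRe G k * ‖modCharSum N T p k‖ ^ 4 := by
  classical
  have h := sum_sum_weight_kernel_eq_fourier G (T ×ˢ T) (fun q => Torus.proj N (q.1 - q.2))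
    (fun q => Complex.exp (-(Complex.I * (phase p (q.1 - q.2) : ℂ))))
  simp_rw [sum_pairWeight_torusChar] at h
  -- the right-hand side is real
  have hW : ∀ k, modCharSum N T p k * conj (modCharSum N T p k) * conj (modCharSum N T p k * conj (modCharSum N T p k)) =
      ((‖modCharSum N T p k‖ ^ 4 : ℝ) : ℂ) := by
    intro k
    rw [Complex.mul_conj, Complex.normSq_eq_norm_sq, Complex.norm_mul, Complex.norm_conj]
    push_cast
    ring
  simp_rw [hW] at h
  have h' := congrArg Complex.re h
  -- real part of the right-hand side
  have hRre : (((N : ℂ) ^ d)⁻¹ * ∑ k, torusFourier (fun z => (G z : ℂ)) k * ((‖modCharSum N T p k‖ ^ 4 : ℝ) : ℂ)).re =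
      ((N : ℝ) ^ d)⁻¹ * ∑ k, torusFourierRe G k * ‖modCharSum N T p k‖ ^ 4 := by
    have hc : (((N : ℂ) ^ d)⁻¹) = ((((N : ℝ) ^ d)⁻¹ : ℝ) : ℂ) := by push_cast; rfl
    rw [hc, Complex.re_ofReal_mul, Complex.re_sum]
    congr 1
    refine Finset.sum_congr rfl fun k _ => ?_
    rw [Complex.mul_re, Complex.ofReal_re, Complex.ofReal_im, mul_zero, sub_zero, torusFourier_ofReal_re]
  rw [hRre] at h'
  rw [← h', Complex.re_sum, Finset.sum_product]
  refine Finset.sum_congr rfl fun u _ => Finset.sum_congr rfl fun v _ => ?_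
  rw [Complex.re_sum, Finset.sum_product]
  refine Finset.sum_congr rfl fun u' _ => Finset.sum_congr rfl fun v' _ => ?_
  dsimp only
  have hm : u - v - (u' - v') = u - v - u' + v' := by abel
  rw [← torusProj_sub, hm, conj_cexp_neg_I_mul, ← Complex.exp_add]
  have e : -(Complex.I * (phase p (u - v) : ℂ)) + Complex.I * (phase p (u' - v') : ℂ) =
      Complex.I * ((-(phase p (u - v - u' + v')) : ℝ) : ℂ) := by
    rw [← hm, phase_sub p (u - v) (u' - v')]
    push_cast
    ring
  rw [e, Complex.re_mul_ofReal, cexp_I_mul_re, Real.cos_neg]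

end Fourfold

/-! ### Positive definiteness of the torus two-point function in Fourier variables -/

section Positivity

variable {N : ℕ} [NeZero N]

/-- `|∑_a χ_k(a)s_a|² = ∑_{a,b} Re(χ_k(a)conj χ_k(b)) s_a s_b` for real `s`. [folklore] -/
theorem normSq_sum_torusChar_mul (k : TorusSite d N) (s : TorusSite d N → ℝ) :
    Complex.normSq (∑ a, torusChar k a * (s a : ℂ)) =
      ∑ a, ∑ b, (torusChar k (a - b)).re * (s a * s b) := by
  have h1 : ((Complex.normSq (∑ a, torusChar k a * (s a : ℂ)) : ℝ) : ℂ) =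
      ∑ b, ∑ a, conj (torusChar k b * (s b : ℂ)) * (torusChar k a * (s a : ℂ)) := by
    rw [Complex.normSq_eq_conj_mul_self, map_sum, Finset.sum_mul_sum]
  have h2 := congrArg Complex.re h1
  rw [Complex.ofReal_re] at h2
  rw [h2, Complex.re_sum]
  simp_rw [Complex.re_sum]
  rw [Finset.sum_comm]
  refine Finset.sum_congr rfl fun a _ => Finset.sum_congr rfl fun b _ => ?_
  rw [map_mul, Complex.conj_ofReal, torusChar_sub_right]
  have : conj (torusChar k b) * (s b : ℂ) * (torusChar k a * (s a : ℂ)) =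
      (torusChar k a * conj (torusChar k b)) * ((s a * s b : ℝ) : ℂ) := by push_cast; ring
  rw [this, Complex.re_mul_ofReal]

/-- **The torus two-point function is positive definite**: for a translation-invariant coupling
matrix `c` on `𝕋_N`, `Ŝ(k) = ∑_z ⟨σ₀σ_z⟩ Re χ_k(z) = N^{-d}⟨|∑_a χ_k(a)σ_a|²⟩ ≥ 0`.
[cite: Panis2023Triviality, §3.3 (Ŝ^{(L)}(p) = ⟨|τ̂(p)|²⟩ ≥ 0)] -/
theorem torusFourierRe_twoPoint_nonneg (c : TorusSite d N → TorusSite d N → ℝ) (β h : ℝ)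
    (hc : ∀ a b t, c (a + t) (b + t) = c a b) (k : TorusSite d N) :
    0 ≤ torusFourierRe (fun z => torusExpect c β h (fun σ => spinAt 0 σ * spinAt z σ)) k := by
  set G : TorusSite d N → ℝ := fun z => torusExpect c β h (fun σ => spinAt 0 σ * spinAt z σ) with hG
  -- `⟨|X|²⟩ ≥ 0`
  have hpos : 0 ≤ torusExpect c β h (fun σ => Complex.normSq (∑ a, torusChar k a * (spinAt a σ : ℂ))) :=
    torusExpect_nonneg c β h fun σ => Complex.normSq_nonneg _
  -- expand
  have hexp : torusExpect c β h (fun σ => Complex.normSq (∑ a, torusChar k a * (spinAt a σ : ℂ))) =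
      ∑ a, ∑ b, (torusChar k (a - b)).re * torusExpect c β h (fun σ => spinAt a σ * spinAt b σ) := by
    simp_rw [normSq_sum_torusChar_mul]
    rw [torusExpect_finset_sum]
    refine Finset.sum_congr rfl fun a _ => ?_
    rw [torusExpect_finset_sum]
    refine Finset.sum_congr rfl fun b _ => ?_
    rw [torusExpect_const_mul]
  -- translation invariance `⟨σ_aσ_b⟩ = G(b - a)`
  have htr : ∀ a b : TorusSite d N, torusExpect c β h (fun σ => spinAt a σ * spinAt b σ) = G (b - a) := by
    intro a b
    have e : (fun σ : SpinConfig (TorusSite d N) => spinAt a σ * spinAt b σ) =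
        fun σ => (fun τ => spinAt 0 τ * spinAt (b - a) τ) (σ ∘ Equiv.addRight a) := by
      funext σ
      show _ = spinAt (Equiv.addRight a 0) σ * spinAt (Equiv.addRight a (b - a)) σ
      simp
    rw [e]
    exact torusExpect_comp_equiv c β h (Equiv.addRight a) (fun x y => hc x y a)
      (fun τ => spinAt 0 τ * spinAt (b - a) τ)
  simp_rw [htr] at hexp
  -- reindex `b ↦ u = b - a`; `Re χ_k(a - b) = Re χ_k(b - a)`
  have hsum : ∑ a : TorusSite d N, ∑ b, (torusChar k (a - b)).re * G (b - a) =
      (N : ℝ) ^ d * torusFourierRe G k := by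
    have h1 : ∀ a : TorusSite d N, ∑ b, (torusChar k (a - b)).re * G (b - a) = ∑ u, (torusChar k u).re * G u := by
      intro a
      rw [← Equiv.sum_comp (Equiv.subRight a) (fun u => (torusChar k u).re * G u)]
      refine Finset.sum_congr rfl fun b _ => ?_
      simp only [Equiv.subRight_apply]
      rw [show a - b = -(b - a) by abel, torusChar_neg_right, Complex.conj_re]
    simp_rw [h1]
    rw [Finset.sum_const, Finset.card_univ, card_torus, nsmul_eq_mul, torusFourierRe]
    push_cast
    congr 1
    exact Finset.sum_congr rfl fun u _ => mul_comm _ _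
  rw [hexp, hsum] at hpos
  have hNd : (0 : ℝ) < (N : ℝ) ^ d := by
    have : (0 : ℝ) < N := by exact_mod_cast Nat.pos_of_ne_zero (NeZero.ne N)
    positivity
  by_contra hneg
  push Not at hneg
  have := mul_neg_of_pos_of_neg hNd hneg
  linarith

end Positivity

/-! ### Anisotropic boxes and the product structure of their character sums -/

section ABox

/-- The anisotropic centred box `∏ᵢ [-Lᵢ, Lᵢ]`. [folklore] -/
def abox (Lv : Fin d → ℕ) : Finset (Site d) := Fintype.piFinset fun i => Finset.Icc (-(Lv i : ℤ)) (Lv i)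

/-- Membership in the anisotropic box. [folklore] -/
theorem mem_abox {Lv : Fin d → ℕ} {x : Site d} : x ∈ abox Lv ↔ ∀ i, -(Lv i : ℤ) ≤ x i ∧ x i ≤ Lv i := by
  simp [abox, Fintype.mem_piFinset]

/-- The isotropic box is `box`. [folklore] -/
theorem abox_const (L : ℕ) : abox (fun _ : Fin d => L) = box d L := rfl

/-- `|abox Lv| = ∏ᵢ (2Lᵢ + 1)`. [folklore] -/
theorem card_abox (Lv : Fin d → ℕ) : #(abox Lv) = ∏ i, (2 * Lv i + 1) := by
  rw [abox, Fintype.card_piFinset]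
  refine Finset.prod_congr rfl fun i _ => ?_
  rw [Int.card_Icc]
  omega

/-- An anisotropic box with radii `≤ L` sits in `Λ_L`. [folklore] -/
theorem abox_subset_box {Lv : Fin d → ℕ} {L : ℕ} (h : ∀ i, Lv i ≤ L) : abox Lv ⊆ box d L := by
  intro x hx
  rw [mem_abox] at hx
  rw [mem_box]
  intro i
  have := hx i
  have := h i
  omega

/-- **The character sum of an anisotropic box factorises**: `∑_{a∈abox Lv} e^{ik·a} = ∏ᵢ D_{Lᵢ}(kᵢ)`. [folklore] -/
theorem sum_abox_cexp_phase (Lv : Fin d → ℕ) (k : Fin d → ℝ) :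
    ∑ a ∈ abox Lv, Complex.exp (Complex.I * (phase k a : ℂ)) = ∏ i, dirichletKernel (Lv i) (k i) := by
  unfold dirichletKernel
  rw [abox, Finset.prod_univ_sum]
  refine Finset.sum_congr rfl fun a _ => ?_
  rw [← Complex.exp_sum]
  congr 1
  rw [phase]
  push_cast
  rw [Finset.mul_sum]

/-- `D_0 ≡ 1`. [folklore] -/
theorem dirichletKernel_zero_left (t : ℝ) : dirichletKernel 0 t = 1 := by
  unfold dirichletKernel
  simp

/-- `‖D_L(t)‖ ≤ 2L + 1`. [folklore] -/
theorem norm_dirichletKernel_le (L : ℕ) (t : ℝ) : ‖dirichletKernel L t‖ ≤ 2 * L + 1 := by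
  rw [norm_dirichletKernel]
  have := norm_geomExp_le (2 * L + 1) t
  push_cast at this
  exact this

/-- `|sin(u/2)| ≥ sin(δ/2)` for `δ ≤ |u| ≤ 2π - δ` (`0 ≤ δ ≤ π`). [folklore] -/
theorem sin_half_le_abs_sin_half {δ u : ℝ} (hδ0 : 0 ≤ δ) (hδπ : δ ≤ Real.pi) (h1 : δ ≤ |u|) (h2 : |u| ≤ 2 * Real.pi - δ) :
    Real.sin (δ / 2) ≤ |Real.sin (u / 2)| := by
  -- reduce to `u ≥ 0` by evenness
  wlog hu : 0 ≤ u generalizing u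
  · have h := this (u := -u) (by rwa [abs_neg]) (by rwa [abs_neg]) (by linarith [le_of_not_ge hu])
    rwa [neg_div, Real.sin_neg, abs_neg] at h
  rw [abs_of_nonneg hu] at h1 h2
  have hs : 0 ≤ Real.sin (u / 2) := Real.sin_nonneg_of_nonneg_of_le_pi (by linarith) (by linarith)
  rw [abs_of_nonneg hs]
  rcases le_total (u / 2) (Real.pi / 2) with hle | hge
  · -- monotone on `[0, π/2]`
    exact Real.sin_le_sin_of_le_of_le_pi_div_two (by linarith) hle (by linarith)
  · -- `sin(u/2) = sin(π - u/2)` with `π - u/2 ∈ [δ/2, π/2]`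
    rw [← Real.sin_pi_sub (u / 2)]
    exact Real.sin_le_sin_of_le_of_le_pi_div_two (by linarith) (by linarith) (by linarith)

/-- **Far from `2πℤ` the Dirichlet kernel is bounded**: `‖D_L(u)‖ ≤ 1/sin(δ/2)` for
`δ ≤ |u| ≤ 2π - δ`, `0 < δ ≤ π`. [folklore] -/
theorem norm_dirichletKernel_le_of_far {L : ℕ} {δ u : ℝ} (hδ : 0 < δ) (hδπ : δ ≤ Real.pi) (h1 : δ ≤ |u|)
    (h2 : |u| ≤ 2 * Real.pi - δ) : ‖dirichletKernel L u‖ ≤ 1 / Real.sin (δ / 2) := by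
  have hsδ : 0 < Real.sin (δ / 2) := Real.sin_pos_of_pos_of_lt_pi (by linarith) (by linarith)
  have hsin := sin_half_le_abs_sin_half hδ.le hδπ h1 h2
  have hne : Real.sin (u / 2) ≠ 0 := fun h => by rw [h, abs_zero] at hsin; linarith
  rw [norm_dirichletKernel]
  refine (norm_geomExp_le_inv_abs_sin hne (2 * L + 1)).trans ?_
  exact one_div_le_one_div_of_le hsδ hsin

end ABox

/-! ### The fourfold counts of a finite set and of boxes -/

section QuadCount

/-- The fourfold count `c_T(m) = #{(u,v,u',v') ∈ T⁴ : u - v - u' + v' = m}` (as a real number). [folklore] -/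
def quadCount (T : Finset (Site d)) (m : Site d) : ℝ :=
  ∑ u ∈ T, ∑ v ∈ T, ∑ u' ∈ T, ∑ v' ∈ T, if u - v - u' + v' = m then 1 else 0

/-- `c_T(m) ≥ 0`. [folklore] -/
theorem quadCount_nonneg (T : Finset (Site d)) (m : Site d) : 0 ≤ quadCount T m :=
  Finset.sum_nonneg fun _ _ => Finset.sum_nonneg fun _ _ => Finset.sum_nonneg fun _ _ =>
    Finset.sum_nonneg fun _ _ => by split_ifs <;> norm_num

/-- `c_T(m) ≤ |T|³` (the last site is determined by the other three). [folklore] -/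
theorem quadCount_le (T : Finset (Site d)) (m : Site d) : quadCount T m ≤ (#T : ℝ) ^ 3 := by
  have h1 : ∀ u v u' : Site d, (∑ v' ∈ T, if u - v - u' + v' = m then (1 : ℝ) else 0) ≤ 1 := by
    intro u v u'
    rw [Finset.sum_boole]
    have : #(T.filter fun v' => u - v - u' + v' = m) ≤ 1 := by
      refine Finset.card_le_one.2 fun a ha b hb => ?_
      have ha' := (Finset.mem_filter.1 ha).2
      have hb' := (Finset.mem_filter.1 hb).2
      have := ha'.trans hb'.symm
      exact add_left_cancel this
    exact_mod_cast this
  calc quadCount T m ≤ ∑ u ∈ T, ∑ v ∈ T, ∑ u' ∈ T, (1 : ℝ) :=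
        Finset.sum_le_sum fun u _ => Finset.sum_le_sum fun v _ => Finset.sum_le_sum fun u' _ => h1 u v u'
    _ = (#T : ℝ) ^ 3 := by simp only [Finset.sum_const, nsmul_eq_mul, mul_one]; ring

variable {N : ℕ} [NeZero N]

/-- Fourfold differences of `Λ_L` lie in `Λ_{4L}`. [folklore] -/
theorem quad_mem_box {L : ℕ} {u v u' v' : Site d} (hu : u ∈ box d L) (hv : v ∈ box d L) (hu' : u' ∈ box d L)
    (hv' : v' ∈ box d L) : u - v - u' + v' ∈ box d (4 * L) := by
  rw [mem_box] at hu hv hu' hv' ⊢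
  intro i
  have := hu i; have := hv i; have := hu' i; have := hv' i
  simp only [Pi.add_apply, Pi.sub_apply]
  push_cast
  omega

/-- **Discrete Plancherel for the fourth power of the modulated character sum**: for `T ⊆ Λ_L` and
`4L < N`, `N^{-d}∑_k ‖W_k‖⁴ = c_T(0)`. [folklore] -/
theorem avg_norm_modCharSum_pow_four {T : Finset (Site d)} {L : ℕ} (hT : T ⊆ box d L) (hN : 4 * L < N)
    (p : Fin d → ℝ) : ((N : ℝ) ^ d)⁻¹ * ∑ k, ‖modCharSum N T p k‖ ^ 4 = quadCount T 0 := by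
  classical
  have h := fourfold_parseval (N := N) (fun z => if z = 0 then (1 : ℝ) else 0) T p
  have hF : ∀ k : TorusSite d N, torusFourierRe (fun z => if z = 0 then (1 : ℝ) else 0) k = 1 := by
    intro k
    rw [torusFourierRe]
    simp
  simp_rw [hF, one_mul] at h
  rw [← h, quadCount]
  refine Finset.sum_congr rfl fun u hu => Finset.sum_congr rfl fun v hv =>
    Finset.sum_congr rfl fun u' hu' => Finset.sum_congr rfl fun v' hv' => ?_
  have hm := quad_mem_box (hT hu) (hT hv) (hT hu') (hT hv')
  by_cases h0 : u - v - u' + v' = 0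
  · rw [if_pos h0, h0]
    simp [phase]
  · rw [if_neg h0, if_neg (proj_ne_zero_of_mem_box hN hm h0), mul_zero]

/-- The one-dimensional fourfold count `c¹_L(t) = #{(a,b,a',b') ∈ [-L,L]⁴ : a - b - a' + b' = t}`. [folklore] -/
def quadCount1 (L : ℕ) (t : ℤ) : ℝ :=
  ∑ a ∈ Finset.Icc (-(L : ℤ)) L, ∑ b ∈ Finset.Icc (-(L : ℤ)) L, ∑ a' ∈ Finset.Icc (-(L : ℤ)) L,
    ∑ b' ∈ Finset.Icc (-(L : ℤ)) L, if a - b - a' + b' = t then 1 else 0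

omit [NeZero N] in
/-- **The fourfold count of an anisotropic box factorises over the coordinates.** [folklore] -/
theorem quadCount_abox (Lv : Fin d → ℕ) (m : Site d) :
    quadCount (abox Lv) m = ∏ i, quadCount1 (Lv i) (m i) := by
  classical
  -- the indicator of the vector identity is the product of the coordinate indicators
  have hind : ∀ u v u' v' : Site d, (if u - v - u' + v' = m then (1 : ℝ) else 0) =
      ∏ i, if u i - v i - u' i + v' i = m i then (1 : ℝ) else 0 := by
    intro u v u' v'
    rw [Finset.prod_boole]
    congr 1
    simp only [Finset.mem_univ, true_implies, funext_iff, Pi.add_apply, Pi.sub_apply]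
  simp only [quadCount, hind, abox, quadCount1]
  -- expand the product of the one-dimensional fourfold sums
  simp_rw [Finset.prod_univ_sum]

/-- The shifted overlap `ψ_L(c) = #{b ∈ [-L,L] : b + c ∈ [-L,L]}`. [folklore] -/
def overlapCount (L : ℕ) (c : ℤ) : ℝ := ∑ b ∈ Finset.Icc (-(L : ℤ)) L, if b + c ∈ Finset.Icc (-(L : ℤ)) L then 1 else 0

omit [NeZero N] in
/-- `ψ_L(c) = (2L + 1 - |c|)₊`. [folklore] -/
theorem overlapCount_eq (L : ℕ) (c : ℤ) : overlapCount L c = max 0 (2 * L + 1 - |(c : ℝ)|) := by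
  rw [overlapCount, Finset.sum_boole]
  have hset : (Finset.Icc (-(L : ℤ)) L).filter (fun b => b + c ∈ Finset.Icc (-(L : ℤ)) L) =
      Finset.Icc (max (-(L : ℤ)) (-L - c)) (min (L : ℤ) (L - c)) := by
    ext b
    simp only [Finset.mem_filter, Finset.mem_Icc, le_min_iff, max_le_iff]
    omega
  rw [hset, Int.card_Icc]
  have key : (((min (L : ℤ) (L - c) + 1 - max (-(L : ℤ)) (-L - c)).toNat : ℕ) : ℤ) = max 0 (2 * L + 1 - |c|) := by
    rcases le_total 0 c with hc | hc
    · have e1 : min (L : ℤ) (L - c) = L - c := min_eq_right (by omega)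
      have e2 : max (-(L : ℤ)) (-L - c) = -L := max_eq_left (by omega)
      rw [e1, e2, abs_of_nonneg hc]
      rcases le_total (2 * (L : ℤ) + 1) c with h1 | h1
      · rw [max_eq_left (by omega : (2 * L + 1 - c : ℤ) ≤ 0)]
        have : ((L : ℤ) - c + 1 - -(L : ℤ)) ≤ 0 := by omega
        rw [Int.toNat_eq_zero.2 this]
        simp
      · rw [max_eq_right (by omega : (0 : ℤ) ≤ 2 * L + 1 - c), Int.toNat_of_nonneg (by omega)]
        omega
    · have e1 : min (L : ℤ) (L - c) = L := min_eq_left (by omega)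
      have e2 : max (-(L : ℤ)) (-L - c) = -L - c := max_eq_right (by omega)
      rw [e1, e2, abs_of_nonpos hc]
      rcases le_total (2 * (L : ℤ) + 1) (-c) with h1 | h1
      · rw [max_eq_left (by omega : (2 * L + 1 - -c : ℤ) ≤ 0)]
        have : ((L : ℤ) + 1 - (-(L : ℤ) - c)) ≤ 0 := by omega
        rw [Int.toNat_eq_zero.2 this]
        simp
      · rw [max_eq_right (by omega : (0 : ℤ) ≤ 2 * L + 1 - -c), Int.toNat_of_nonneg (by omega)]
        omega
  have key' := congrArg (Int.cast : ℤ → ℝ) key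
  push_cast at key'
  exact key'

omit [NeZero N] in
/-- `ψ_L` is `1`-Lipschitz. [folklore] -/
theorem abs_overlapCount_sub_le (L : ℕ) (c c' : ℤ) : |overlapCount L c - overlapCount L c'| ≤ |(c : ℝ) - c'| := by
  rw [overlapCount_eq, overlapCount_eq]
  have h1 : |(|(c : ℝ)| - |(c' : ℝ)|)| ≤ |(c : ℝ) - c'| := abs_abs_sub_abs_le_abs_sub _ _
  rcases abs_le.1 h1 with ⟨h2, h3⟩
  rw [abs_le]
  constructor <;>
    rcases le_total 0 (2 * (L : ℝ) + 1 - |(c : ℝ)|) with ha | ha <;>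
    rcases le_total 0 (2 * (L : ℝ) + 1 - |(c' : ℝ)|) with hb | hb <;>
    simp only [max_eq_right ha, max_eq_left ha, max_eq_right hb, max_eq_left hb] <;> linarith

omit [NeZero N] in
/-- `0 ≤ ψ_L ≤ 2L + 1`. [folklore] -/
theorem overlapCount_le (L : ℕ) (c : ℤ) : overlapCount L c ≤ 2 * L + 1 := by
  rw [overlapCount_eq]
  exact max_le (by positivity) (by linarith [abs_nonneg (c : ℝ)])

omit [NeZero N] in
/-- The fourfold count through the overlap: `c¹_L(t) = ∑_{a',b'∈[-L,L]} ψ_L(t + a' - b')`. [folklore] -/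
theorem quadCount1_eq_sum_overlap (L : ℕ) (t : ℤ) :
    quadCount1 L t = ∑ a' ∈ Finset.Icc (-(L : ℤ)) L, ∑ b' ∈ Finset.Icc (-(L : ℤ)) L, overlapCount L (t + a' - b') := by
  rw [quadCount1, Finset.sum_comm]
  -- sum out `a` first: for fixed `b, a', b'` exactly one `a` works iff `t + b + a' - b' ∈ [-L,L]`
  have h1 : ∀ b a' b' : ℤ, (∑ a ∈ Finset.Icc (-(L : ℤ)) L, if a - b - a' + b' = t then (1 : ℝ) else 0) =
      if b + (t + a' - b') ∈ Finset.Icc (-(L : ℤ)) L then 1 else 0 := by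
    intro b a' b'
    have : ∀ a : ℤ, (a - b - a' + b' = t) ↔ a = b + (t + a' - b') := fun a => by constructor <;> intro h <;> omega
    simp_rw [this]
    rw [Finset.sum_ite_eq']
  calc ∑ b ∈ Finset.Icc (-(L : ℤ)) L, ∑ a ∈ Finset.Icc (-(L : ℤ)) L, ∑ a' ∈ Finset.Icc (-(L : ℤ)) L,
        ∑ b' ∈ Finset.Icc (-(L : ℤ)) L, (if a - b - a' + b' = t then (1 : ℝ) else 0)
      = ∑ b ∈ Finset.Icc (-(L : ℤ)) L, ∑ a' ∈ Finset.Icc (-(L : ℤ)) L, ∑ b' ∈ Finset.Icc (-(L : ℤ)) L,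
          ∑ a ∈ Finset.Icc (-(L : ℤ)) L, (if a - b - a' + b' = t then (1 : ℝ) else 0) := by
        refine Finset.sum_congr rfl fun b _ => ?_
        rw [Finset.sum_comm]
        refine Finset.sum_congr rfl fun a' _ => ?_
        rw [Finset.sum_comm]
    _ = ∑ b ∈ Finset.Icc (-(L : ℤ)) L, ∑ a' ∈ Finset.Icc (-(L : ℤ)) L, ∑ b' ∈ Finset.Icc (-(L : ℤ)) L,
          (if b + (t + a' - b') ∈ Finset.Icc (-(L : ℤ)) L then (1 : ℝ) else 0) := by
        simp_rw [h1]
    _ = ∑ a' ∈ Finset.Icc (-(L : ℤ)) L, ∑ b' ∈ Finset.Icc (-(L : ℤ)) L, overlapCount L (t + a' - b') := by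
        rw [Finset.sum_comm]
        refine Finset.sum_congr rfl fun a' _ => ?_
        rw [Finset.sum_comm]
        rfl

omit [NeZero N] in
/-- **Lipschitz dependence of the fourfold count on the target**: `|c¹_L(t) - c¹_L(0)| ≤ (2L+1)²|t|`. [folklore] -/
theorem abs_quadCount1_sub_le (L : ℕ) (t : ℤ) : |quadCount1 L t - quadCount1 L 0| ≤ (2 * L + 1) ^ 2 * |(t : ℝ)| := by
  rw [quadCount1_eq_sum_overlap, quadCount1_eq_sum_overlap, ← Finset.sum_sub_distrib]
  refine (Finset.abs_sum_le_sum_abs _ _).trans ?_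
  have h1 : ∀ a' ∈ Finset.Icc (-(L : ℤ)) L, |∑ b' ∈ Finset.Icc (-(L : ℤ)) L, overlapCount L (t + a' - b') -
      ∑ b' ∈ Finset.Icc (-(L : ℤ)) L, overlapCount L (0 + a' - b')| ≤ (2 * L + 1) * |(t : ℝ)| := by
    intro a' _
    rw [← Finset.sum_sub_distrib]
    refine (Finset.abs_sum_le_sum_abs _ _).trans ?_
    calc ∑ b' ∈ Finset.Icc (-(L : ℤ)) L, |overlapCount L (t + a' - b') - overlapCount L (0 + a' - b')|
        ≤ ∑ b' ∈ Finset.Icc (-(L : ℤ)) L, |(t : ℝ)| := Finset.sum_le_sum fun b' _ => by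
          refine (abs_overlapCount_sub_le L _ _).trans (le_of_eq ?_)
          push_cast
          ring_nf
      _ = (2 * L + 1) * |(t : ℝ)| := by
          rw [Finset.sum_const, Int.card_Icc, nsmul_eq_mul]
          have : ((L : ℤ) + 1 - -(L : ℤ)).toNat = 2 * L + 1 := by omega
          rw [this]
          push_cast
          ring
  calc ∑ a' ∈ Finset.Icc (-(L : ℤ)) L, |∑ b' ∈ Finset.Icc (-(L : ℤ)) L, overlapCount L (t + a' - b') -
        ∑ b' ∈ Finset.Icc (-(L : ℤ)) L, overlapCount L (0 + a' - b')|
      ≤ ∑ a' ∈ Finset.Icc (-(L : ℤ)) L, (2 * L + 1) * |(t : ℝ)| := Finset.sum_le_sum h1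
    _ = (2 * L + 1) ^ 2 * |(t : ℝ)| := by
        rw [Finset.sum_const, Int.card_Icc, nsmul_eq_mul]
        have : ((L : ℤ) + 1 - -(L : ℤ)).toNat = 2 * L + 1 := by omega
        rw [this]
        push_cast
        ring

omit [NeZero N] in
/-- **The fourfold count is of order `L³`**: `c¹_L(0) ≥ L³`. [folklore] -/
theorem pow_three_le_quadCount1 (L : ℕ) : (L : ℝ) ^ 3 ≤ quadCount1 L 0 := by
  rw [quadCount1_eq_sum_overlap]
  set H : ℕ := L / 2 with hH
  have hsub : Finset.Icc (-(H : ℤ)) H ⊆ Finset.Icc (-(L : ℤ)) L := by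
    intro x hx
    simp only [Finset.mem_Icc] at hx ⊢
    omega
  have hnn : ∀ a' b' : ℤ, 0 ≤ overlapCount L (0 + a' - b') := fun a' b' => by
    rw [overlapCount_eq]; exact le_max_left _ _
  have h1 : ∑ a' ∈ Finset.Icc (-(H : ℤ)) H, ∑ b' ∈ Finset.Icc (-(H : ℤ)) H, ((L : ℝ) + 1) ≤
      ∑ a' ∈ Finset.Icc (-(L : ℤ)) L, ∑ b' ∈ Finset.Icc (-(L : ℤ)) L, overlapCount L (0 + a' - b') := by
    calc ∑ a' ∈ Finset.Icc (-(H : ℤ)) H, ∑ b' ∈ Finset.Icc (-(H : ℤ)) H, ((L : ℝ) + 1)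
        ≤ ∑ a' ∈ Finset.Icc (-(H : ℤ)) H, ∑ b' ∈ Finset.Icc (-(H : ℤ)) H, overlapCount L (0 + a' - b') := by
          refine Finset.sum_le_sum fun a' ha' => Finset.sum_le_sum fun b' hb' => ?_
          simp only [Finset.mem_Icc] at ha' hb'
          rw [overlapCount_eq]
          refine le_trans ?_ (le_max_right _ _)
          have : |((0 + a' - b' : ℤ) : ℝ)| ≤ L := by
            rw [← Int.cast_abs]
            exact_mod_cast (abs_le.2 ⟨by omega, by omega⟩)
          linarith
      _ ≤ ∑ a' ∈ Finset.Icc (-(L : ℤ)) L, ∑ b' ∈ Finset.Icc (-(H : ℤ)) H, overlapCount L (0 + a' - b') :=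
          Finset.sum_le_sum_of_subset_of_nonneg hsub fun a' _ _ => Finset.sum_nonneg fun b' _ => hnn a' b'
      _ ≤ ∑ a' ∈ Finset.Icc (-(L : ℤ)) L, ∑ b' ∈ Finset.Icc (-(L : ℤ)) L, overlapCount L (0 + a' - b') :=
          Finset.sum_le_sum fun a' _ => Finset.sum_le_sum_of_subset_of_nonneg hsub fun b' _ _ => hnn a' b'
  refine le_trans ?_ h1
  rw [Finset.sum_const, Finset.sum_const, Int.card_Icc, smul_smul, nsmul_eq_mul]
  have hc : ((H : ℤ) + 1 - -(H : ℤ)).toNat = 2 * H + 1 := by omega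
  rw [hc]
  have hHL : (L : ℝ) ≤ 2 * H + 1 := by
    have : L ≤ 2 * H + 1 := by omega
    exact_mod_cast this
  have hL0 : (0 : ℝ) ≤ L := Nat.cast_nonneg L
  push_cast
  nlinarith [mul_le_mul hHL hHL hL0 (by positivity)]

omit [NeZero N] in
/-- `c¹_L(t) ≤ (2L+1)³`. [folklore] -/
theorem quadCount1_le (L : ℕ) (t : ℤ) : quadCount1 L t ≤ (2 * L + 1) ^ 3 := by
  rw [quadCount1_eq_sum_overlap]
  calc ∑ a' ∈ Finset.Icc (-(L : ℤ)) L, ∑ b' ∈ Finset.Icc (-(L : ℤ)) L, overlapCount L (t + a' - b')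
      ≤ ∑ a' ∈ Finset.Icc (-(L : ℤ)) L, ∑ b' ∈ Finset.Icc (-(L : ℤ)) L, (2 * (L : ℝ) + 1) :=
        Finset.sum_le_sum fun a' _ => Finset.sum_le_sum fun b' _ => overlapCount_le L _
    _ = (2 * L + 1) ^ 3 := by
        rw [Finset.sum_const, Finset.sum_const, Int.card_Icc, smul_smul, nsmul_eq_mul]
        have hc : ((L : ℤ) + 1 - -(L : ℤ)).toNat = 2 * L + 1 := by omega
        rw [hc]
        push_cast
        ring

omit [NeZero N] in
/-- `c¹_L(t) ≥ 0`. [folklore] -/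
theorem quadCount1_nonneg (L : ℕ) (t : ℤ) : 0 ≤ quadCount1 L t := by
  rw [quadCount1_eq_sum_overlap]
  exact Finset.sum_nonneg fun a' _ => Finset.sum_nonneg fun b' _ => by rw [overlapCount_eq]; exact le_max_left _ _

omit [NeZero N] in
/-- **The normalised fourfold counts tend to one**: `c¹_L(t)/c¹_L(0) → 1` as `L → ∞`. [folklore] -/
theorem tendsto_quadCount1_div (t : ℤ) :
    Tendsto (fun L : ℕ => quadCount1 L t / quadCount1 L 0) atTop (𝓝 1) := by
  rw [Metric.tendsto_atTop]
  intro ε hε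
  obtain ⟨L₀, hL₀⟩ := exists_nat_gt (9 * |(t : ℝ)| / ε)
  refine ⟨max L₀ 1, fun L hL => ?_⟩
  have hL1 : 1 ≤ L := le_of_max_le_right hL
  have hL1' : (1 : ℝ) ≤ L := by exact_mod_cast hL1
  have hLL₀ : (L₀ : ℝ) ≤ L := by exact_mod_cast le_of_max_le_left hL
  have hq0 : (L : ℝ) ^ 3 ≤ quadCount1 L 0 := pow_three_le_quadCount1 L
  have hq0pos : 0 < quadCount1 L 0 := lt_of_lt_of_le (by positivity) hq0
  have hdiff := abs_quadCount1_sub_le L t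
  rw [Real.dist_eq, div_sub_one hq0pos.ne', abs_div, abs_of_pos hq0pos, div_lt_iff₀ hq0pos]
  have h9 : (2 * (L : ℝ) + 1) ^ 2 ≤ 9 * (L : ℝ) ^ 2 := by nlinarith
  have hlt : 9 * |(t : ℝ)| < ε * L := by
    have := (div_lt_iff₀ hε).1 (hL₀.trans_le hLL₀)
    linarith
  calc |quadCount1 L t - quadCount1 L 0| ≤ (2 * L + 1) ^ 2 * |(t : ℝ)| := hdiff
    _ ≤ 9 * (L : ℝ) ^ 2 * |(t : ℝ)| := by gcongr
    _ = (L : ℝ) ^ 2 * (9 * |(t : ℝ)|) := by ring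
    _ < (L : ℝ) ^ 2 * (ε * L) := mul_lt_mul_of_pos_left hlt (by positivity)
    _ = ε * (L : ℝ) ^ 3 := by ring
    _ ≤ ε * quadCount1 L 0 := by gcongr

omit [NeZero N] in
/-- **In every dimension the normalised fourfold counts of the boxes tend to one**:
`c_{Λ_L}(m)/c_{Λ_L}(0) → 1`. [folklore] -/
theorem tendsto_quadCount_box_div (m : Site d) :
    Tendsto (fun L : ℕ => quadCount (box d L) m / quadCount (box d L) 0) atTop (𝓝 1) := by
  have h : ∀ L : ℕ, quadCount (box d L) m / quadCount (box d L) 0 = ∏ i, (quadCount1 L (m i) / quadCount1 L 0) := by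
    intro L
    rw [← abox_const, quadCount_abox, quadCount_abox, ← Finset.prod_div_distrib]
    rfl
  simp_rw [h]
  have := tendsto_finsetProd (Finset.univ : Finset (Fin d)) fun i _ => tendsto_quadCount1_div (m i)
  simpa using this

omit [NeZero N] in
/-- **Uniform bound on the normalised fourfold counts**: `c_{Λ_L}(m)/c_{Λ_L}(0) ≤ 27^d` (`L ≥ 1`). [folklore] -/
theorem quadCount_box_div_le {L : ℕ} (hL : 1 ≤ L) (m : Site d) :
    quadCount (box d L) m / quadCount (box d L) 0 ≤ (27 : ℝ) ^ d := by
  rw [← abox_const, quadCount_abox, quadCount_abox, ← Finset.prod_div_distrib]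
  have hL1 : (1 : ℝ) ≤ L := by exact_mod_cast hL
  have h1 : ∀ i, quadCount1 L (m i) / quadCount1 L 0 ≤ 27 := by
    intro i
    have hq0 : (L : ℝ) ^ 3 ≤ quadCount1 L 0 := pow_three_le_quadCount1 L
    have hq0pos : 0 < quadCount1 L 0 := lt_of_lt_of_le (by positivity) hq0
    rw [div_le_iff₀ hq0pos]
    calc quadCount1 L (m i) ≤ (2 * L + 1) ^ 3 := quadCount1_le L (m i)
      _ ≤ (3 * (L : ℝ)) ^ 3 := by gcongr; linarith
      _ = 27 * (L : ℝ) ^ 3 := by ring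
      _ ≤ 27 * quadCount1 L 0 := by gcongr
  calc ∏ i, quadCount1 L (m i) / quadCount1 L 0 ≤ ∏ _i : Fin d, (27 : ℝ) :=
        Finset.prod_le_prod (fun i _ => div_nonneg (quadCount1_nonneg L _) (quadCount1_nonneg L 0)) fun i _ => h1 i
    _ = 27 ^ d := by simp

omit [NeZero N] in
/-- **Lower bound on the fourfold count of a box**: `c_{Λ_L}(0) ≥ L^{3d}`. [folklore] -/
theorem pow_le_quadCount_box (L : ℕ) : ((L : ℝ) ^ 3) ^ d ≤ quadCount (box d L) 0 := by
  rw [← abox_const, quadCount_abox]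
  calc ((L : ℝ) ^ 3) ^ d = ∏ _i : Fin d, (L : ℝ) ^ 3 := by simp
    _ ≤ ∏ i, quadCount1 L ((0 : Site d) i) :=
        Finset.prod_le_prod (fun i _ => by positivity) fun i _ => by simpa using pow_three_le_quadCount1 L

end QuadCount

/-! ### The kernel of the box and of its slabs; the three regions of torus momenta -/

section Kernel

variable {N : ℕ} [NeZero N]

/-- **The modulated character sum of an anisotropic box, fourth power of the norm**:
`‖W_k‖⁴ = ∏ᵢ ‖D_{Lᵢ}(θ_{k,i} - pᵢ)‖⁴`. [folklore] -/
theorem norm_modCharSum_abox_pow_four (Lv : Fin d → ℕ) (p : Fin d → ℝ) (k : TorusSite d N) :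
    ‖modCharSum N (abox Lv) p k‖ ^ 4 = ∏ i, ‖dirichletKernel (Lv i) (centeredMomentum N k i - p i)‖ ^ 4 := by
  rw [modCharSum, sum_abox_cexp_phase, norm_prod, ← Finset.prod_pow]
  rfl

/-- The slab of `Λ_L` orthogonal to the direction `i` (radius `0` in that direction). [folklore] -/
def slabRadii (d L : ℕ) (i : Fin d) : Fin d → ℕ := Function.update (fun _ => L) i 0

omit [NeZero N] in
/-- The slab sits in `Λ_L`. [folklore] -/
theorem abox_slabRadii_subset (L : ℕ) (i : Fin d) : abox (slabRadii d L i) ⊆ box d L :=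
  abox_subset_box fun j => by
    unfold slabRadii Function.update
    split_ifs <;> simp

omit [NeZero N] in
/-- `|slab| = (2L+1)^{d-1} ≤ (2L+1)^d`; we only use `|slab| ≤ (2L+1)^{d-1}` in the form below. [folklore] -/
theorem card_abox_slabRadii (L : ℕ) (i : Fin d) : (#(abox (slabRadii d L i)) : ℝ) = (2 * L + 1 : ℝ) ^ (d - 1) := by
  rw [card_abox]
  push_cast
  rw [← Finset.mul_prod_erase Finset.univ _ (Finset.mem_univ i)]
  have h1 : (2 * (slabRadii d L i i : ℝ) + 1) = 1 := by simp [slabRadii]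
  have h2 : ∀ j ∈ Finset.univ.erase i, (2 * (slabRadii d L i j : ℝ) + 1) = 2 * L + 1 := by
    intro j hj
    have hji : j ≠ i := Finset.ne_of_mem_erase hj
    simp [slabRadii, Function.update, hji]
  rw [h1, one_mul, Finset.prod_congr rfl h2, Finset.prod_const, Finset.card_erase_of_mem (Finset.mem_univ i),
    Finset.card_univ, Fintype.card_fin]

/-- The partial kernel `P_i(k) = ∏_{j≠i} ‖D_L(θ_{k,j} - p_j)‖⁴`. [folklore] -/
def partialKernel (N : ℕ) [NeZero N] (L : ℕ) (p : Fin d → ℝ) (i : Fin d) (k : TorusSite d N) : ℝ :=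
  ∏ j ∈ Finset.univ.erase i, ‖dirichletKernel L (centeredMomentum N k j - p j)‖ ^ 4

/-- `P_i ≥ 0`. [folklore] -/
theorem partialKernel_nonneg (L : ℕ) (p : Fin d → ℝ) (i : Fin d) (k : TorusSite d N) : 0 ≤ partialKernel N L p i k :=
  Finset.prod_nonneg fun _ _ => by positivity

/-- **The box kernel splits off one coordinate**: `‖W_k(Λ_L)‖⁴ = ‖D_L(θ_{k,i}-pᵢ)‖⁴ P_i(k)`. [folklore] -/
theorem norm_modCharSum_box_pow_four_eq (L : ℕ) (p : Fin d → ℝ) (i : Fin d) (k : TorusSite d N) :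
    ‖modCharSum N (box d L) p k‖ ^ 4 =
      ‖dirichletKernel L (centeredMomentum N k i - p i)‖ ^ 4 * partialKernel N L p i k := by
  rw [← abox_const, norm_modCharSum_abox_pow_four, partialKernel,
    ← Finset.mul_prod_erase Finset.univ _ (Finset.mem_univ i)]

/-- **The slab kernel is the partial kernel**: `‖W_k(slab_i)‖⁴ = P_i(k)` (`D_0 ≡ 1`). [folklore] -/
theorem norm_modCharSum_slab_pow_four_eq (L : ℕ) (p : Fin d → ℝ) (i : Fin d) (k : TorusSite d N) :
    ‖modCharSum N (abox (slabRadii d L i)) p k‖ ^ 4 = partialKernel N L p i k := by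
  rw [norm_modCharSum_abox_pow_four, partialKernel, ← Finset.mul_prod_erase Finset.univ _ (Finset.mem_univ i)]
  have h1 : slabRadii d L i i = 0 := by simp [slabRadii]
  rw [h1, dirichletKernel_zero_left, norm_one, one_pow, one_mul]
  refine Finset.prod_congr rfl fun j hj => ?_
  have hji : j ≠ i := Finset.ne_of_mem_erase hj
  simp [slabRadii, Function.update, hji]

/-- **Total mass of the partial kernel**: `∑_k P_i(k) = N^d c_{slab_i}(0) ≤ N^d (2L+1)^{3(d-1)}`
(`4L < N`). [folklore] -/
theorem sum_partialKernel_le {L : ℕ} (hLN : 4 * L < N) (p : Fin d → ℝ) (i : Fin d) :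
    ∑ k, partialKernel N L p i k ≤ (N : ℝ) ^ d * ((2 * L + 1 : ℝ) ^ (d - 1)) ^ 3 := by
  have h := avg_norm_modCharSum_pow_four (N := N) (abox_slabRadii_subset L i) hLN p
  simp_rw [norm_modCharSum_slab_pow_four_eq] at h
  have hNd : (0 : ℝ) < (N : ℝ) ^ d := by
    have : (0 : ℝ) < N := by exact_mod_cast Nat.pos_of_ne_zero (NeZero.ne N)
    positivity
  have h2 : ∑ k, partialKernel N L p i k = (N : ℝ) ^ d * quadCount (abox (slabRadii d L i)) 0 := by
    rw [← h, ← mul_assoc, mul_inv_cancel₀ hNd.ne', one_mul]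
  rw [h2, ← card_abox_slabRadii L i]
  exact mul_le_mul_of_nonneg_left (quadCount_le _ _) hNd.le

variable {C₀ α : ℝ}

/-- The torus two-point function `G_N(z) = ⟨σ₀σ_z⟩_{𝕋_N,J^{(N)},β}` is nonnegative (GKS I). [cite: FriedliVelenik2017, Thm. 3.49, eq. (3.54)] -/
theorem torusPair_nonneg (hC₀ : 0 ≤ C₀) {β : ℝ} (hβ : 0 ≤ β) (z : TorusSite d N) :
    0 ≤ torusExpect (torusCoupling (algebraicCoupling d C₀ α) N) β 0 (fun σ => spinAt 0 σ * spinAt z σ) := by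
  have e : (fun σ : SpinConfig (TorusSite d N) => spinAt 0 σ * spinAt z σ) = spinProduct ({0} ∆ {z}) := by
    funext σ; exact spinAt_mul_spinAt_eq_spinProduct 0 z σ
  rw [e]
  exact torusExpect_spinProduct_nonneg _ β 0 hβ le_rfl (torusCoupling_nonneg _ N (algebraicCoupling_nonneg hC₀ α)) _

/-- **The fourfold sum of the slab is controlled by a single box sum of the torus two-point function**:
`∑_{slab_i⁴} cos(p·m) G_N(m̄) ≤ |slab_i|³ ∑_{m∈Λ_{4L}} G_N(m̄)`. [folklore] -/
theorem fourfold_slab_le (hC₀ : 0 ≤ C₀) {β : ℝ} (hβ : 0 ≤ β) (L : ℕ) (p : Fin d → ℝ) (i : Fin d) :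
    ∑ u ∈ abox (slabRadii d L i), ∑ v ∈ abox (slabRadii d L i), ∑ u' ∈ abox (slabRadii d L i), ∑ v' ∈ abox (slabRadii d L i),
        Real.cos (phase p (u - v - u' + v')) *
          torusExpect (torusCoupling (algebraicCoupling d C₀ α) N) β 0
            (fun σ => spinAt 0 σ * spinAt (Torus.proj N (u - v - u' + v')) σ) ≤
      ((2 * L + 1 : ℝ) ^ (d - 1)) ^ 3 *
        ∑ m ∈ box d (4 * L), torusExpect (torusCoupling (algebraicCoupling d C₀ α) N) β 0
          (fun σ => spinAt 0 σ * spinAt (Torus.proj N m) σ) := by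
  set T := abox (slabRadii d L i) with hT
  set G : Site d → ℝ := fun m => torusExpect (torusCoupling (algebraicCoupling d C₀ α) N) β 0
    (fun σ => spinAt 0 σ * spinAt (Torus.proj N m) σ) with hG
  have hG0 : ∀ m, 0 ≤ G m := fun m => torusPair_nonneg hC₀ hβ _
  have hTsub : T ⊆ box d L := abox_slabRadii_subset L i
  -- the innermost sum is at most the full box sum
  have hinner : ∀ u ∈ T, ∀ v ∈ T, ∀ u' ∈ T,
      ∑ v' ∈ T, Real.cos (phase p (u - v - u' + v')) * G (u - v - u' + v') ≤ ∑ m ∈ box d (4 * L), G m := by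
    intro u hu v hv u' hu'
    calc ∑ v' ∈ T, Real.cos (phase p (u - v - u' + v')) * G (u - v - u' + v')
        ≤ ∑ v' ∈ T, G (u - v - u' + v') := Finset.sum_le_sum fun v' _ =>
          (mul_le_of_le_one_left (hG0 _) (Real.cos_le_one _))
      _ = ∑ m ∈ T.image (fun v' => u - v - u' + v'), G m := by
          rw [Finset.sum_image fun a _ b _ h => add_left_cancel h]
      _ ≤ ∑ m ∈ box d (4 * L), G m := by
          refine Finset.sum_le_sum_of_subset_of_nonneg (fun m hm => ?_) fun m _ _ => hG0 m
          obtain ⟨v', hv', rfl⟩ := Finset.mem_image.1 hm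
          exact quad_mem_box (hTsub hu) (hTsub hv) (hTsub hu') (hTsub hv')
  calc ∑ u ∈ T, ∑ v ∈ T, ∑ u' ∈ T, ∑ v' ∈ T, Real.cos (phase p (u - v - u' + v')) * G (u - v - u' + v')
      ≤ ∑ u ∈ T, ∑ v ∈ T, ∑ u' ∈ T, ∑ m ∈ box d (4 * L), G m :=
        Finset.sum_le_sum fun u hu => Finset.sum_le_sum fun v hv => Finset.sum_le_sum fun u' hu' => hinner u hu v hv u' hu'
    _ = (#T : ℝ) ^ 3 * ∑ m ∈ box d (4 * L), G m := by
        simp only [Finset.sum_const, nsmul_eq_mul]; ring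
    _ = ((2 * L + 1 : ℝ) ^ (d - 1)) ^ 3 * ∑ m ∈ box d (4 * L), G m := by rw [hT, card_abox_slabRadii]

/-- Membership in the near region: every coordinate of `θ_k - p` is within `δ` of `2πℤ`. [folklore] -/
def IsNear (N : ℕ) [NeZero N] (p : Fin d → ℝ) (δ : ℝ) (k : TorusSite d N) :=
  ∀ i, |centeredMomentum N k i - p i| < δ ∨ 2 * Real.pi - δ < |centeredMomentum N k i - p i|

/-- Membership in the small cube about the origin. [folklore] -/
def IsSmall (N : ℕ) [NeZero N] (r : ℝ) (k : TorusSite d N) := ∀ i, |centeredMomentum N k i| < r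

/-- **Near momenta are `p + η` modulo `2πℤ^d` with `‖η‖_∞ < δ`** (`|θ|, |p| ≤ π`, `δ ≤ π`):
there are `η` with `|ηᵢ| < δ` and `q ∈ ℤ^d` with `θ_k = p + η + 2πq`. [folklore] -/
theorem exists_eta_of_isNear {p : Fin d → ℝ} (hp : ∀ i, |p i| ≤ Real.pi) {δ : ℝ}
    {k : TorusSite d N} (hk : IsNear N p δ k) :
    ∃ (η : Fin d → ℝ) (q : Fin d → ℤ), (∀ i, |η i| < δ) ∧
      centeredMomentum N k = fun i => (p + η) i + 2 * Real.pi * q i := by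
  classical
  set θ := centeredMomentum N k with hθ
  set q : Fin d → ℤ := fun i => if |θ i - p i| < δ then 0 else if 0 < θ i - p i then 1 else -1 with hq
  refine ⟨fun i => θ i - p i - 2 * Real.pi * q i, q, fun i => ?_, ?_⟩
  · have hθi := abs_centeredMomentum_le k i
    rw [← hθ] at hθi
    have hpi := hp i
    have hki := hk i
    simp only [hq]
    split_ifs with h1 h2
    · push_cast; simpa using h1
    · rcases hki with h | h
      · exact absurd h h1
      · have hub : |θ i - p i| ≤ 2 * Real.pi := by
          calc |θ i - p i| ≤ |θ i| + |p i| := abs_sub _ _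
            _ ≤ 2 * Real.pi := by linarith
        rw [abs_of_pos h2] at h hub
        push_cast
        rw [abs_lt]
        constructor <;> linarith
    · rcases hki with h | h
      · exact absurd h h1
      · have hub : |θ i - p i| ≤ 2 * Real.pi := by
          calc |θ i - p i| ≤ |θ i| + |p i| := abs_sub _ _
            _ ≤ 2 * Real.pi := by linarith
        have hneg : θ i - p i ≤ 0 := le_of_not_gt h2
        rw [abs_of_nonpos hneg] at h hub
        push_cast
        rw [abs_lt]
        constructor <;> linarith
  · funext i
    simp only [Pi.add_apply]
    ring

/-- The origin is not near `p` when `δ ≤ |p_{i₀}|` (and `|p_{i₀}| ≤ π`, `δ > 0`... ): `0 ∉ Near`. [folklore] -/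
theorem not_isNear_zero {p : Fin d → ℝ} (hp : ∀ i, |p i| ≤ Real.pi) {δ : ℝ} {i₀ : Fin d}
    (hδp : δ ≤ |p i₀|) : ¬ IsNear N p δ (0 : TorusSite d N) := by
  intro h
  have h0 : centeredMomentum N (0 : TorusSite d N) i₀ = 0 :=
    (centeredMomentum_apply_eq_zero_iff (0 : TorusSite d N) i₀).2 rfl
  rcases h i₀ with h1 | h1
  · rw [h0, zero_sub, abs_neg] at h1; linarith
  · rw [h0, zero_sub, abs_neg] at h1
    have := hp i₀
    linarith [Real.pi_pos]

/-- Outside the near region some coordinate of `θ_k - p` is at distance `≥ δ` from `2πℤ`: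
`δ ≤ |θ_{k,i} - p_i| ≤ 2π - δ`. [folklore] -/
theorem exists_far_of_not_isNear {p : Fin d → ℝ} {δ : ℝ} {k : TorusSite d N} (hk : ¬ IsNear N p δ k) :
    ∃ i, δ ≤ |centeredMomentum N k i - p i| ∧ |centeredMomentum N k i - p i| ≤ 2 * Real.pi - δ := by
  simp only [IsNear, not_forall, not_or, not_lt] at hk
  obtain ⟨i, h1, h2⟩ := hk
  exact ⟨i, h1, h2⟩

/-- In the small cube the distinguished coordinate is far from `p_{i₀}`: for `|θ_{k,i₀}| < r ≤ |p_{i₀}|/2`,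
`|p_{i₀}|/2 ≤ |θ_{k,i₀} - p_{i₀}| ≤ 2π - |p_{i₀}|/2`. [folklore] -/
theorem far_of_isSmall {p : Fin d → ℝ} (hp : ∀ i, |p i| ≤ Real.pi) {r : ℝ} {i₀ : Fin d} (hr : r ≤ |p i₀| / 2)
    {k : TorusSite d N} (hk : IsSmall N r k) :
    |p i₀| / 2 ≤ |centeredMomentum N k i₀ - p i₀| ∧ |centeredMomentum N k i₀ - p i₀| ≤ 2 * Real.pi - |p i₀| / 2 := by
  have h1 := hk i₀
  have h2 := hp i₀
  have h3 := abs_centeredMomentum_le k i₀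
  constructor
  · have := abs_sub_abs_le_abs_sub (p i₀) (centeredMomentum N k i₀)
    rw [abs_sub_comm] at this
    linarith
  · calc |centeredMomentum N k i₀ - p i₀| ≤ |centeredMomentum N k i₀| + |p i₀| := abs_sub _ _
      _ ≤ 2 * Real.pi - |p i₀| / 2 := by linarith [abs_nonneg (p i₀)]

/-- Outside the small cube the momentum has norm `≥ r`. [folklore] -/
theorem le_norm_of_not_isSmall {r : ℝ} {k : TorusSite d N} (hk : ¬ IsSmall N r k) : r ≤ ‖centeredMomentum N k‖ := by
  simp only [IsSmall, not_forall, not_lt] at hk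
  obtain ⟨i, hi⟩ := hk
  exact hi.trans (norm_le_pi_norm (centeredMomentum N k) i)

end Kernel

/-! ### The Fourier side at finite `N`: the three-region bound -/

section FiniteN

variable {N : ℕ} [NeZero N] {C₀ α : ℝ}

/-- Sums of nonnegative functions over a filtered set are at most the full sums. [folklore] -/
theorem sum_filter_le_sum_univ {ι : Type*} [Fintype ι] (P : ι → Prop) [DecidablePred P] {f : ι → ℝ}
    (hf : ∀ i, 0 ≤ f i) : ∑ i ∈ Finset.univ.filter P, f i ≤ ∑ i, f i :=
  Finset.sum_le_sum_of_subset_of_nonneg (Finset.filter_subset _ _) fun i _ _ => hf i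

/-- **The three-region bound on the Fourier side** (finite even torus `𝕋_N`, `N ≥ 4`, `4L < N`).
With `G_N(z) = ⟨σ₀σ_z⟩_{𝕋_N,J^{(N)},β}`, `Ŝ_N = torusFourierRe G_N`, `W_k` the modulated character sum of
`Λ_L`, a direction `i₀` with `p_{i₀} ≠ 0`, a near-width `δ ≤ |p_{i₀}|/2` on which
`1/(β|J|(1-Ĵ(p+η))) ≤ B_p + ω`, and the cube gap bound `1 - Ĵ(q) ≥ c₁‖q‖²`:
`N^{-d}∑_k Ŝ_N(k)‖W_k‖⁴ ≤ (B_p+ω)c_{Λ_L}(0) + M C_δ d (2L+1)^{3(d-1)} + C' (2L+1)^{3(d-1)} ∑_{m∈Λ_{4L}}G_N(m̄)`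
(near momenta: the torus infrared bound and continuity; far momenta off the small cube: the infrared
bound is at most `M = 1/(β|J|c₁(|p_{i₀}|/2)²)` and one Dirichlet factor is small; the small cube:
positivity of `Ŝ_N` and the slab Parseval identity). [cite: Panis2023Triviality, Propositions 3.4 and 3.7] -/
theorem fourierSide_le (hd : 1 ≤ d) (hC₀ : 0 < C₀) (hα : 0 < α) (hNe : Even N) (hN4 : 4 ≤ N)
    {β : ℝ} (hβ : 0 < β) {L : ℕ} (hLN : 4 * L < N)
    {p : Fin d → ℝ} (hp : ∀ i, |p i| ≤ Real.pi) {i₀ : Fin d} (hp0 : 0 < |p i₀|)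
    {δ : ℝ} (hδ : 0 < δ) (hδp : δ ≤ |p i₀| / 2) {Bp ω : ℝ} (hBω : 0 ≤ Bp + ω)
    (hcont : ∀ η : Fin d → ℝ, (∀ i, |η i| < δ) →
      0 < 1 - couplingFourier (algebraicCoupling d C₀ α) (p + η) ∧
        1 / (β * (couplingNorm (algebraicCoupling d C₀ α) *
          (1 - couplingFourier (algebraicCoupling d C₀ α) (p + η)))) ≤ Bp + ω)
    {c₁ : ℝ} (hc₁ : 0 < c₁)
    (hgap : ∀ q : Fin d → ℝ, ‖q‖ ≤ Real.pi → c₁ * ‖q‖ ^ 2 ≤ 1 - couplingFourier (algebraicCoupling d C₀ α) q) :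
    ((N : ℝ) ^ d)⁻¹ * ∑ k, torusFourierRe (fun z => torusExpect (torusCoupling (algebraicCoupling d C₀ α) N) β 0
        (fun σ => spinAt 0 σ * spinAt z σ)) k * ‖modCharSum N (box d L) p k‖ ^ 4 ≤
      (Bp + ω) * quadCount (box d L) 0 +
      1 / (β * (couplingNorm (algebraicCoupling d C₀ α) * (c₁ * (|p i₀| / 2) ^ 2))) *
          (1 / Real.sin (δ / 2)) ^ 4 * (d * ((2 * L + 1 : ℝ) ^ (d - 1)) ^ 3) +
      (1 / Real.sin (|p i₀| / 4)) ^ 4 * (((2 * L + 1 : ℝ) ^ (d - 1)) ^ 3 *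
        ∑ m ∈ box d (4 * L), torusExpect (torusCoupling (algebraicCoupling d C₀ α) N) β 0
          (fun σ => spinAt 0 σ * spinAt (Torus.proj N m) σ)) := by
  classical
  set J := algebraicCoupling d C₀ α with hJ
  set G : TorusSite d N → ℝ := fun z => torusExpect (torusCoupling J N) β 0 (fun σ => spinAt 0 σ * spinAt z σ) with hG
  set S : TorusSite d N → ℝ := torusFourierRe G with hS
  set K : TorusSite d N → ℝ := fun k => ‖modCharSum N (box d L) p k‖ ^ 4 with hK
  set P : Fin d → TorusSite d N → ℝ := fun i k => partialKernel N L p i k with hP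
  set r : ℝ := |p i₀| / 2 with hr
  set s : ℝ := ((2 * L + 1 : ℝ) ^ (d - 1)) ^ 3 with hs
  set M : ℝ := 1 / (β * (couplingNorm J * (c₁ * r ^ 2))) with hM
  set Cδ : ℝ := (1 / Real.sin (δ / 2)) ^ 4 with hCδ
  set C' : ℝ := (1 / Real.sin (|p i₀| / 4)) ^ 4 with hC'
  set Sb : ℝ := ∑ m ∈ box d (4 * L), torusExpect (torusCoupling J N) β 0
    (fun σ => spinAt 0 σ * spinAt (Torus.proj N m) σ) with hSb
  have hJt : ∀ a x y, J (x + a) (y + a) = J x y := algebraicCoupling_add C₀ α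
  have hpos := couplingNorm_algebraic_pos hd hC₀ hα
  have hπ := Real.pi_pos
  have hpπ : |p i₀| ≤ Real.pi := hp i₀
  have hr0 : 0 < r := by positivity
  have hNd : (0 : ℝ) < (N : ℝ) ^ d := by
    have : (0 : ℝ) < N := by exact_mod_cast Nat.pos_of_ne_zero (NeZero.ne N)
    positivity
  -- nonnegativity
  have hS0 : ∀ k, 0 ≤ S k := fun k =>
    torusFourierRe_twoPoint_nonneg (torusCoupling J N) β 0 (fun a b t => torusCoupling_add_right J N hJt a b t) k
  have hK0 : ∀ k, 0 ≤ K k := fun k => by positivity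
  have hP0 : ∀ i k, 0 ≤ P i k := fun i k => partialKernel_nonneg L p i k
  have hM0 : 0 ≤ M := by positivity
  have hsδ : 0 < Real.sin (δ / 2) := Real.sin_pos_of_pos_of_lt_pi (by linarith) (by linarith)
  have hsp : 0 < Real.sin (|p i₀| / 4) := Real.sin_pos_of_pos_of_lt_pi (by linarith) (by linarith)
  have hCδ0 : 0 ≤ Cδ := by positivity
  have hC'0 : 0 ≤ C' := by positivity
  -- the torus infrared bound
  have hIR : ∀ k : TorusSite d N, 0 < 1 - couplingFourier J (centeredMomentum N k) →
      S k ≤ 1 / (β * (couplingNorm J * (1 - couplingFourier J (centeredMomentum N k)))) := fun k hk =>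
    torus_twoPointFourier_le hd hC₀ hα hNe hN4 hβ hk
  -- the kernel splits off any coordinate
  have hKP : ∀ i k, K k = ‖dirichletKernel L (centeredMomentum N k i - p i)‖ ^ 4 * P i k := fun i k =>
    norm_modCharSum_box_pow_four_eq L p i k
  ---------------------------------------------------------------- termwise bounds
  -- (A) near momenta
  have hA : ∀ k, IsNear N p δ k → S k * K k ≤ (Bp + ω) * K k := by
    intro k hk
    refine mul_le_mul_of_nonneg_right ?_ (hK0 k)
    obtain ⟨η, q, hη, hθ⟩ := exists_eta_of_isNear hp hk
    have hper : couplingFourier J (centeredMomentum N k) = couplingFourier J (p + η) := by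
      rw [hθ, couplingFourier_add_two_pi_mul]
    obtain ⟨hgap', hle⟩ := hcont η hη
    have h1 := hIR k (by rwa [hper])
    rw [hper] at h1
    exact h1.trans hle
  -- (B1) far momenta off the small cube
  have hB1 : ∀ k, ¬ IsNear N p δ k → ¬ IsSmall N r k → S k * K k ≤ M * Cδ * ∑ i, P i k := by
    intro k hk hks
    obtain ⟨i, hfar1, hfar2⟩ := exists_far_of_not_isNear hk
    have hnorm := le_norm_of_not_isSmall hks
    have hθπ := norm_centeredMomentum_le (N := N) k
    have hg := hgap _ hθπ
    have hlow : c₁ * r ^ 2 ≤ 1 - couplingFourier J (centeredMomentum N k) :=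
      le_trans (mul_le_mul_of_nonneg_left (pow_le_pow_left₀ hr0.le hnorm 2) hc₁.le) hg
    have hgpos : 0 < 1 - couplingFourier J (centeredMomentum N k) := lt_of_lt_of_le (by positivity) hlow
    have hSk : S k ≤ M := by
      refine (hIR k hgpos).trans ?_
      rw [hM]
      apply one_div_le_one_div_of_le (by positivity)
      exact mul_le_mul_of_nonneg_left (mul_le_mul_of_nonneg_left hlow hpos.le) hβ.le
    have hDi : ‖dirichletKernel L (centeredMomentum N k i - p i)‖ ^ 4 ≤ Cδ := by
      rw [hCδ]
      exact pow_le_pow_left₀ (norm_nonneg _) (norm_dirichletKernel_le_of_far hδ (by linarith) hfar1 hfar2) 4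
    have hKk : K k ≤ Cδ * ∑ j, P j k := by
      rw [hKP i k]
      calc ‖dirichletKernel L (centeredMomentum N k i - p i)‖ ^ 4 * P i k ≤ Cδ * P i k :=
            mul_le_mul_of_nonneg_right hDi (hP0 i k)
        _ ≤ Cδ * ∑ j, P j k :=
            mul_le_mul_of_nonneg_left (Finset.single_le_sum (fun j _ => hP0 j k) (Finset.mem_univ i)) hCδ0
    calc S k * K k ≤ M * (Cδ * ∑ j, P j k) := mul_le_mul hSk hKk (hK0 k) hM0
      _ = M * Cδ * ∑ i, P i k := by ring
  -- (B2) the small cube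
  have hB2 : ∀ k, IsSmall N r k → S k * K k ≤ C' * (S k * P i₀ k) := by
    intro k hks
    obtain ⟨hfar1, hfar2⟩ := far_of_isSmall hp (le_refl (|p i₀| / 2)) hks
    have hDi : ‖dirichletKernel L (centeredMomentum N k i₀ - p i₀)‖ ^ 4 ≤ C' := by
      rw [hC']
      have h := norm_dirichletKernel_le_of_far (L := L) (δ := |p i₀| / 2) (by positivity) (by linarith) hfar1 hfar2
      rw [show |p i₀| / 2 / 2 = |p i₀| / 4 by ring] at h
      exact pow_le_pow_left₀ (norm_nonneg _) h 4
    rw [hKP i₀ k]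
    calc S k * (‖dirichletKernel L (centeredMomentum N k i₀ - p i₀)‖ ^ 4 * P i₀ k)
        = ‖dirichletKernel L (centeredMomentum N k i₀ - p i₀)‖ ^ 4 * (S k * P i₀ k) := by ring
      _ ≤ C' * (S k * P i₀ k) := mul_le_mul_of_nonneg_right hDi (mul_nonneg (hS0 k) (hP0 i₀ k))
  ---------------------------------------------------------------- the split
  have hsplit : ∑ k, S k * K k =
      ∑ k ∈ Finset.univ.filter (fun k => IsNear N p δ k), S k * K k +
      (∑ k ∈ (Finset.univ.filter (fun k => ¬ IsNear N p δ k)).filter (fun k => IsSmall N r k), S k * K k +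
       ∑ k ∈ (Finset.univ.filter (fun k => ¬ IsNear N p δ k)).filter (fun k => ¬ IsSmall N r k), S k * K k) := by
    symm
    rw [Finset.sum_filter_add_sum_filter_not, Finset.sum_filter_add_sum_filter_not]
  -- (A) summed
  have hAsum : ∑ k ∈ Finset.univ.filter (fun k => IsNear N p δ k), S k * K k ≤ (Bp + ω) * ((N : ℝ) ^ d * quadCount (box d L) 0) := by
    calc ∑ k ∈ Finset.univ.filter (fun k => IsNear N p δ k), S k * K k
        ≤ ∑ k ∈ Finset.univ.filter (fun k => IsNear N p δ k), (Bp + ω) * K k :=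
          Finset.sum_le_sum fun k hk => hA k (Finset.mem_filter.1 hk).2
      _ ≤ ∑ k, (Bp + ω) * K k := sum_filter_le_sum_univ _ fun k => mul_nonneg hBω (hK0 k)
      _ = (Bp + ω) * ((N : ℝ) ^ d * quadCount (box d L) 0) := by
          rw [← Finset.mul_sum]
          congr 1
          have h := avg_norm_modCharSum_pow_four (N := N) (subset_refl (box d L)) hLN p
          rw [← h, ← mul_assoc, mul_inv_cancel₀ hNd.ne', one_mul]
  -- (B1) summed
  have hB1sum : ∑ k ∈ (Finset.univ.filter (fun k => ¬ IsNear N p δ k)).filter (fun k => ¬ IsSmall N r k), S k * K k ≤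
      M * Cδ * (d * ((N : ℝ) ^ d * s)) := by
    rw [Finset.filter_filter]
    calc ∑ k ∈ Finset.univ.filter (fun k => ¬ IsNear N p δ k ∧ ¬ IsSmall N r k), S k * K k
        ≤ ∑ k ∈ Finset.univ.filter (fun k => ¬ IsNear N p δ k ∧ ¬ IsSmall N r k), M * Cδ * ∑ i, P i k :=
          Finset.sum_le_sum fun k hk => hB1 k (Finset.mem_filter.1 hk).2.1 (Finset.mem_filter.1 hk).2.2
      _ ≤ ∑ k, M * Cδ * ∑ i, P i k :=
          sum_filter_le_sum_univ _ fun k => mul_nonneg (mul_nonneg hM0 hCδ0) (Finset.sum_nonneg fun i _ => hP0 i k)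
      _ = M * Cδ * ∑ i, ∑ k, P i k := by rw [← Finset.mul_sum, Finset.sum_comm]
      _ ≤ M * Cδ * ∑ _i : Fin d, (N : ℝ) ^ d * s := by
          refine mul_le_mul_of_nonneg_left (Finset.sum_le_sum fun i _ => ?_) (mul_nonneg hM0 hCδ0)
          exact sum_partialKernel_le hLN p i
      _ = M * Cδ * (d * ((N : ℝ) ^ d * s)) := by
          rw [Finset.sum_const, Finset.card_univ, Fintype.card_fin, nsmul_eq_mul]
  -- (B2) summed
  have hB2sum : ∑ k ∈ (Finset.univ.filter (fun k => ¬ IsNear N p δ k)).filter (fun k => IsSmall N r k), S k * K k ≤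
      C' * ((N : ℝ) ^ d * (s * Sb)) := by
    rw [Finset.filter_filter]
    calc ∑ k ∈ Finset.univ.filter (fun k => ¬ IsNear N p δ k ∧ IsSmall N r k), S k * K k
        ≤ ∑ k ∈ Finset.univ.filter (fun k => ¬ IsNear N p δ k ∧ IsSmall N r k), C' * (S k * P i₀ k) :=
          Finset.sum_le_sum fun k hk => hB2 k (Finset.mem_filter.1 hk).2.2
      _ ≤ ∑ k, C' * (S k * P i₀ k) :=
          sum_filter_le_sum_univ _ fun k => mul_nonneg hC'0 (mul_nonneg (hS0 k) (hP0 i₀ k))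
      _ = C' * ∑ k, S k * ‖modCharSum N (abox (slabRadii d L i₀)) p k‖ ^ 4 := by
          rw [← Finset.mul_sum]
          congr 1
          refine Finset.sum_congr rfl fun k _ => ?_
          rw [norm_modCharSum_slab_pow_four_eq]
      _ ≤ C' * ((N : ℝ) ^ d * (s * Sb)) := by
          refine mul_le_mul_of_nonneg_left ?_ hC'0
          have h := fourfold_parseval (N := N) G (abox (slabRadii d L i₀)) p
          have h2 : ∑ k, S k * ‖modCharSum N (abox (slabRadii d L i₀)) p k‖ ^ 4 =
              (N : ℝ) ^ d * ∑ u ∈ abox (slabRadii d L i₀), ∑ v ∈ abox (slabRadii d L i₀),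
                ∑ u' ∈ abox (slabRadii d L i₀), ∑ v' ∈ abox (slabRadii d L i₀),
                  Real.cos (phase p (u - v - u' + v')) * G (Torus.proj N (u - v - u' + v')) := by
            rw [h, ← mul_assoc, mul_inv_cancel₀ hNd.ne', one_mul]
          rw [h2]
          exact mul_le_mul_of_nonneg_left (fourfold_slab_le hC₀.le hβ.le L p i₀) hNd.le
  ---------------------------------------------------------------- assemble
  have htot : ∑ k, S k * K k ≤ (Bp + ω) * ((N : ℝ) ^ d * quadCount (box d L) 0) +
      (C' * ((N : ℝ) ^ d * (s * Sb)) + M * Cδ * (d * ((N : ℝ) ^ d * s))) := by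
    rw [hsplit]
    exact add_le_add hAsum (add_le_add hB2sum hB1sum)
  calc ((N : ℝ) ^ d)⁻¹ * ∑ k, S k * K k
      ≤ ((N : ℝ) ^ d)⁻¹ * ((Bp + ω) * ((N : ℝ) ^ d * quadCount (box d L) 0) +
          (C' * ((N : ℝ) ^ d * (s * Sb)) + M * Cδ * (d * ((N : ℝ) ^ d * s)))) :=
        mul_le_mul_of_nonneg_left htot (by positivity)
    _ = (Bp + ω) * quadCount (box d L) 0 + M * Cδ * (d * s) + C' * (s * Sb) := by
        field_simp
        ring

end FiniteN

/-! ### Passing to the limit `N → ∞` along the even tori `𝕋_{2M+2}` -/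

section EvenTori

variable {C₀ α : ℝ}

/-- `J_{x,y} = J_{y,x}` for the algebraically decaying coupling. [folklore] -/
theorem algebraicCoupling_comm (C₀ α : ℝ) (x y : Site d) : algebraicCoupling d C₀ α x y = algebraicCoupling d C₀ α y x := by
  unfold algebraicCoupling
  by_cases h : x = y
  · subst h; rfl
  · rw [if_neg h, if_neg (Ne.symm h)]
    congr 3
    unfold l1Norm
    refine Finset.sum_congr rfl fun i _ => ?_
    rw [Pi.sub_apply, Pi.sub_apply, ← Int.natAbs_neg, neg_sub]

/-- **The torus two-point function along the even tori converges to the free two-point function below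
`β_c`** (`abs_torusPair_sub_pairCorrelation_le` with `m*(β) = 0` for `β < β_c`).
[cite: Panis2023Triviality, proof of Proposition 3.7 (⟨τ₀τ_x⟩_{𝕋_L,ρ,β} → ⟨τ₀τ_x⟩_{ρ,β})] -/
theorem tendsto_torusPair_even (hd : 1 ≤ d) (hC₀ : 0 < C₀) (hα : 0 < α) {β : ℝ} (hβ : 0 < β)
    (hβc : β < LongRangeIsing.criticalBeta (algebraicCoupling d C₀ α)) (z : Site d) :
    Tendsto (fun M : ℕ => torusExpect (torusCoupling (algebraicCoupling d C₀ α) (2 * M + 1 + 1)) β 0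
      (fun σ => spinAt 0 σ * spinAt (Torus.proj (2 * M + 1 + 1) z) σ)) atTop
      (𝓝 (pairCorrelation (algebraicCoupling d C₀ α) β 0 z)) := by
  set J := algebraicCoupling d C₀ α with hJ
  have hJ0 : ∀ x y, 0 ≤ J x y := algebraicCoupling_nonneg hC₀.le α
  have hJt : ∀ a x y, J (x + a) (y + a) = J x y := algebraicCoupling_add C₀ α
  have hJs : Summable (J 0) := algebraicCoupling_zero_summable hd hC₀.le hα
  have hJsym : ∀ x y, J x y = J y x := algebraicCoupling_comm C₀ α
  have hm := magnetization_eq_zero_of_lt_criticalBeta J β hβ hβc hJ0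
  rw [Metric.tendsto_atTop]
  intro ε hε
  obtain ⟨N₀, hN₀⟩ := abs_torusPair_sub_pairCorrelation_le hβ hJ0 hJt hJs hJsym hm z (half_pos hε)
  refine ⟨N₀, fun M hM => ?_⟩
  have h := hN₀ (2 * M + 1 + 1) (by omega)
  rw [Real.dist_eq]
  linarith

/-- **The fourfold torus sums converge to the fourfold free sums** (finite sums). [folklore] -/
theorem tendsto_fourfold_even (hd : 1 ≤ d) (hC₀ : 0 < C₀) (hα : 0 < α) {β : ℝ} (hβ : 0 < β)
    (hβc : β < LongRangeIsing.criticalBeta (algebraicCoupling d C₀ α)) (L : ℕ) (p : Fin d → ℝ) :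
    Tendsto (fun M : ℕ => ∑ u ∈ box d L, ∑ v ∈ box d L, ∑ u' ∈ box d L, ∑ v' ∈ box d L,
        Real.cos (phase p (u - v - u' + v')) *
          torusExpect (torusCoupling (algebraicCoupling d C₀ α) (2 * M + 1 + 1)) β 0
            (fun σ => spinAt 0 σ * spinAt (Torus.proj (2 * M + 1 + 1) (u - v - u' + v')) σ)) atTop
      (𝓝 (∑ u ∈ box d L, ∑ v ∈ box d L, ∑ u' ∈ box d L, ∑ v' ∈ box d L,
        Real.cos (phase p (u - v - u' + v')) * pairCorrelation (algebraicCoupling d C₀ α) β 0 (u - v - u' + v'))) := by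
  refine tendsto_finsetSum _ fun u _ => tendsto_finsetSum _ fun v _ => tendsto_finsetSum _ fun u' _ =>
    tendsto_finsetSum _ fun v' _ => ?_
  exact (tendsto_torusPair_even hd hC₀ hα hβ hβc _).const_mul _

variable {N : ℕ} [NeZero N]

omit [NeZero N] in
/-- **A single box sum of a nonnegative torus kernel is controlled by a double box sum**:
`|Λ_n| ∑_{m∈Λ_n} G(m̄) ≤ ∑_{x,y∈Λ_{2n}} G(x̄ - ȳ)`. [folklore] -/
theorem card_mul_sum_box_le_sum_sum (G : TorusSite d N → ℝ) (hG : ∀ z, 0 ≤ G z) (n : ℕ) :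
    (#(box d n) : ℝ) * ∑ m ∈ box d n, G (Torus.proj N m) ≤
      ∑ x ∈ box d (2 * n), ∑ y ∈ box d (2 * n), G (Torus.proj N x - Torus.proj N y) := by
  have hsub : box d n ⊆ box d (2 * n) := box_mono d (by omega)
  have hrow : ∀ x ∈ box d n, ∑ m ∈ box d n, G (Torus.proj N m) ≤ ∑ y ∈ box d (2 * n), G (Torus.proj N x - Torus.proj N y) := by
    intro x hx
    have h1 : ∑ m ∈ box d n, G (Torus.proj N m) = ∑ y ∈ (box d n).image (fun m => x - m), G (Torus.proj N x - Torus.proj N y) := by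
      rw [Finset.sum_image fun a _ b _ h => sub_right_injective h]
      refine Finset.sum_congr rfl fun m _ => ?_
      rw [← torusProj_sub, sub_sub_cancel]
    rw [h1]
    refine Finset.sum_le_sum_of_subset_of_nonneg (fun y hy => ?_) fun y _ _ => hG _
    obtain ⟨m, hm, rfl⟩ := Finset.mem_image.1 hy
    rw [mem_box] at hx hm ⊢
    intro i
    have := hx i; have := hm i
    simp only [Pi.sub_apply]
    push_cast
    omega
  calc (#(box d n) : ℝ) * ∑ m ∈ box d n, G (Torus.proj N m)
      = ∑ _x ∈ box d n, ∑ m ∈ box d n, G (Torus.proj N m) := by rw [Finset.sum_const, nsmul_eq_mul]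
    _ ≤ ∑ x ∈ box d n, ∑ y ∈ box d (2 * n), G (Torus.proj N x - Torus.proj N y) := Finset.sum_le_sum hrow
    _ ≤ ∑ x ∈ box d (2 * n), ∑ y ∈ box d (2 * n), G (Torus.proj N x - Torus.proj N y) :=
        Finset.sum_le_sum_of_subset_of_nonneg hsub fun x _ _ => Finset.sum_nonneg fun y _ => hG _

/-- The single box sum is trivially at most the number of terms (`G ≤ 1`). [folklore] -/
theorem sum_box_torusPair_le_card {β : ℝ} (n : ℕ) :
    ∑ m ∈ box d n, torusExpect (torusCoupling (algebraicCoupling d C₀ α) N) β 0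
        (fun σ => spinAt 0 σ * spinAt (Torus.proj N m) σ) ≤ #(box d n) := by
  calc ∑ m ∈ box d n, torusExpect (torusCoupling (algebraicCoupling d C₀ α) N) β 0
        (fun σ => spinAt 0 σ * spinAt (Torus.proj N m) σ) ≤ ∑ _m ∈ box d n, (1 : ℝ) :=
        Finset.sum_le_sum fun m _ => (le_abs_self _).trans (abs_torusExpect_le_one _ β 0 fun σ => by
          rw [abs_mul, abs_spinAt, abs_spinAt, one_mul])
    _ = #(box d n) := by simp

end EvenTori

section NLimit

variable {C₀ α : ℝ}

/-- **The single box sum of the torus two-point function in `d ≥ 3`** (through the double box sum and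
the torus infrared bound in `x`-space, `torus_sum_sum_box_le`): for `N` even, `N ≥ 112L`, `L ≥ 1`,
`|Λ_{4L}|∑_{m∈Λ_{4L}}G_N(m̄) ≤ N^{-d}(∑_zG_N(z))(2·8L+1)^{2d} + C_K (8L)^{d+α∧2}/β`.
[cite: Panis2023Triviality, proof of Proposition 3.8 (torus version)] -/
theorem card_mul_sum_box_torusPair_le (hd : 3 ≤ d) (hC₀ : 0 < C₀) (hα : 0 < α) {c' : ℝ} (hc' : 0 < c')
    (hglob : ∀ q : Fin d → ℝ, ‖q‖ ≤ Real.pi →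
      c' * ‖q‖ ^ min α 2 ≤ 1 - couplingFourier (algebraicCoupling d C₀ α) q)
    {N : ℕ} [NeZero N] (hNe : Even N) {L : ℕ} (hL : 1 ≤ L) (hNL : 112 * L ≤ N) {β : ℝ} (hβ : 0 < β) :
    (#(box d (4 * L)) : ℝ) * ∑ m ∈ box d (4 * L), torusExpect (torusCoupling (algebraicCoupling d C₀ α) N) β 0
        (fun σ => spinAt 0 σ * spinAt (Torus.proj N m) σ) ≤
      ((N : ℝ) ^ d)⁻¹ * (∑ z, torusExpect (torusCoupling (algebraicCoupling d C₀ α) N) β 0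
          (fun σ => spinAt 0 σ * spinAt z σ)) * ((((2 * (2 * (4 * L)) + 1 : ℕ) : ℝ) ^ d) ^ 2) +
        (9 * Real.pi ^ 2) ^ d * (394 + 2 / (1 - min α 2 / d)) ^ d /
          (couplingNorm (algebraicCoupling d C₀ α) * c') * ((2 * (4 * L) : ℕ) : ℝ) ^ ((d : ℝ) + min α 2) / β := by
  refine (card_mul_sum_box_le_sum_sum _ (fun z => torusPair_nonneg hC₀.le hβ.le z) (4 * L)).trans ?_
  exact torus_sum_sum_box_le hd hC₀ hα hc' hglob hNe (L := 2 * (4 * L)) (by omega) (by omega) hβ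

/-- **The limit `N → ∞` of the three-region bound** (fixed `L ≥ 1`): if along the even tori the single box
sum `∑_{m∈Λ_{4L}}G_{2M+2}(m̄)` is eventually at most `T + ε'` for every `ε' > 0`, then the fourfold FREE sum
obeys `∑_{Λ_L⁴} cos(p·m) S_β(m) ≤ (B_p+ω)c_{Λ_L}(0) + M C_δ d (2L+1)^{3(d-1)} + C'(2L+1)^{3(d-1)} T`.
[cite: Panis2023Triviality, proof of Proposition 3.7] -/
theorem fourfoldFree_le (hd : 1 ≤ d) (hC₀ : 0 < C₀) (hα : 0 < α) {β : ℝ} (hβ : 0 < β)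
    (hβc : β < LongRangeIsing.criticalBeta (algebraicCoupling d C₀ α)) (L : ℕ)
    {p : Fin d → ℝ} (hp : ∀ i, |p i| ≤ Real.pi) {i₀ : Fin d} (hp0 : 0 < |p i₀|)
    {δ : ℝ} (hδ : 0 < δ) (hδp : δ ≤ |p i₀| / 2) {Bp ω : ℝ} (hBω : 0 ≤ Bp + ω)
    (hcont : ∀ η : Fin d → ℝ, (∀ i, |η i| < δ) →
      0 < 1 - couplingFourier (algebraicCoupling d C₀ α) (p + η) ∧
        1 / (β * (couplingNorm (algebraicCoupling d C₀ α) *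
          (1 - couplingFourier (algebraicCoupling d C₀ α) (p + η)))) ≤ Bp + ω)
    {c₁ : ℝ} (hc₁ : 0 < c₁)
    (hgap : ∀ q : Fin d → ℝ, ‖q‖ ≤ Real.pi → c₁ * ‖q‖ ^ 2 ≤ 1 - couplingFourier (algebraicCoupling d C₀ α) q)
    {T : ℝ} (hSb : ∀ ε' : ℝ, 0 < ε' → ∀ᶠ M : ℕ in atTop,
      ∑ m ∈ box d (4 * L), torusExpect (torusCoupling (algebraicCoupling d C₀ α) (2 * M + 1 + 1)) β 0
        (fun σ => spinAt 0 σ * spinAt (Torus.proj (2 * M + 1 + 1) m) σ) ≤ T + ε') :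
    ∑ u ∈ box d L, ∑ v ∈ box d L, ∑ u' ∈ box d L, ∑ v' ∈ box d L,
        Real.cos (phase p (u - v - u' + v')) * pairCorrelation (algebraicCoupling d C₀ α) β 0 (u - v - u' + v') ≤
      (Bp + ω) * quadCount (box d L) 0 +
      1 / (β * (couplingNorm (algebraicCoupling d C₀ α) * (c₁ * (|p i₀| / 2) ^ 2))) *
          (1 / Real.sin (δ / 2)) ^ 4 * (d * ((2 * L + 1 : ℝ) ^ (d - 1)) ^ 3) +
      (1 / Real.sin (|p i₀| / 4)) ^ 4 * (((2 * L + 1 : ℝ) ^ (d - 1)) ^ 3 * T) := by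
  set J := algebraicCoupling d C₀ α with hJ
  set s : ℝ := ((2 * L + 1 : ℝ) ^ (d - 1)) ^ 3 with hs
  set C' : ℝ := (1 / Real.sin (|p i₀| / 4)) ^ 4 with hC'
  set R : ℝ := (Bp + ω) * quadCount (box d L) 0 +
      1 / (β * (couplingNorm J * (c₁ * (|p i₀| / 2) ^ 2))) * (1 / Real.sin (δ / 2)) ^ 4 * (d * s) with hR
  have hπ := Real.pi_pos
  have hpπ : |p i₀| ≤ Real.pi := hp i₀
  have hsp : 0 < Real.sin (|p i₀| / 4) := Real.sin_pos_of_pos_of_lt_pi (by linarith) (by linarith)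
  have hC'0 : 0 ≤ C' := by positivity
  have hs0 : 0 ≤ s := by positivity
  have hlim := tendsto_fourfold_even hd hC₀ hα hβ hβc L p
  -- `Qinf ≤ R + C' s (T + ε')` for every `ε' > 0`
  have key : ∀ ε' : ℝ, 0 < ε' → ∑ u ∈ box d L, ∑ v ∈ box d L, ∑ u' ∈ box d L, ∑ v' ∈ box d L,
      Real.cos (phase p (u - v - u' + v')) * pairCorrelation J β 0 (u - v - u' + v') ≤ R + C' * (s * (T + ε')) := by
    intro ε' hε'
    refine le_of_tendsto hlim ?_
    filter_upwards [hSb ε' hε', eventually_ge_atTop (4 * L + 2)] with M hM hML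
    have hN4 : 4 ≤ 2 * M + 1 + 1 := by omega
    have hLN : 4 * L < 2 * M + 1 + 1 := by omega
    have hNe : Even (2 * M + 1 + 1) := ⟨M + 1, by ring⟩
    have hfs := fourierSide_le (N := 2 * M + 1 + 1) hd hC₀ hα hNe hN4 hβ hLN hp hp0 hδ hδp hBω hcont hc₁ hgap
    rw [← fourfold_parseval] at hfs
    refine hfs.trans ?_
    rw [hR]
    refine add_le_add le_rfl (mul_le_mul_of_nonneg_left (mul_le_mul_of_nonneg_left hM hs0) hC'0)
  -- let `ε' → 0`
  have hmain : ∑ u ∈ box d L, ∑ v ∈ box d L, ∑ u' ∈ box d L, ∑ v' ∈ box d L,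
      Real.cos (phase p (u - v - u' + v')) * pairCorrelation J β 0 (u - v - u' + v') ≤ R + C' * (s * T) := by
    refine le_of_forall_pos_le_add fun ε hε => ?_
    by_cases h0 : C' * s = 0
    · have := key 1 one_pos
      have e : C' * (s * (T + 1)) = C' * (s * T) := by
        have : C' * s * 1 = 0 := by rw [h0, zero_mul]
        nlinarith [this]
      linarith
    · have hCs : 0 < C' * s := lt_of_le_of_ne (mul_nonneg hC'0 hs0) (Ne.symm h0)
      have := key (ε / (C' * s)) (div_pos hε hCs)
      have hC'ne : C' ≠ 0 := fun h => h0 (by rw [h, zero_mul])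
      have hsne : s ≠ 0 := fun h => h0 (by rw [h, mul_zero])
      have e : C' * (s * (T + ε / (C' * s))) = C' * (s * T) + ε := by field_simp
      linarith
  rw [hR] at hmain
  exact hmain

end NLimit

/-! ### Passing to the limit `L → ∞`: regrouping by the difference and dominated convergence -/

section LLimit

/-- **Regrouping the fourfold sum by the difference**: `∑_{Λ_L⁴} f(u-v-u'+v') = ∑_{m∈Λ_{4L}} c_{Λ_L}(m) f(m)`. [folklore] -/
theorem fourfold_eq_sum_quadCount (L : ℕ) (f : Site d → ℝ) :
    ∑ u ∈ box d L, ∑ v ∈ box d L, ∑ u' ∈ box d L, ∑ v' ∈ box d L, f (u - v - u' + v') =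
      ∑ m ∈ box d (4 * L), quadCount (box d L) m * f m := by
  have h1 : ∀ u ∈ box d L, ∀ v ∈ box d L, ∀ u' ∈ box d L, ∀ v' ∈ box d L,
      f (u - v - u' + v') = ∑ m ∈ box d (4 * L), (if u - v - u' + v' = m then (1 : ℝ) else 0) * f m := by
    intro u hu v hv u' hu' v' hv'
    simp_rw [ite_mul, one_mul, zero_mul]
    rw [Finset.sum_ite_eq]
    rw [if_pos (quad_mem_box hu hv hu' hv')]
  calc ∑ u ∈ box d L, ∑ v ∈ box d L, ∑ u' ∈ box d L, ∑ v' ∈ box d L, f (u - v - u' + v')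
      = ∑ u ∈ box d L, ∑ v ∈ box d L, ∑ u' ∈ box d L, ∑ v' ∈ box d L,
          ∑ m ∈ box d (4 * L), (if u - v - u' + v' = m then (1 : ℝ) else 0) * f m :=
        Finset.sum_congr rfl fun u hu => Finset.sum_congr rfl fun v hv => Finset.sum_congr rfl fun u' hu' =>
          Finset.sum_congr rfl fun v' hv' => h1 u hu v hv u' hu' v' hv'
    _ = ∑ m ∈ box d (4 * L), ∑ u ∈ box d L, ∑ v ∈ box d L, ∑ u' ∈ box d L, ∑ v' ∈ box d L,
          (if u - v - u' + v' = m then (1 : ℝ) else 0) * f m := by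
        simp only [Finset.sum_comm (s := box d L) (t := box d (4 * L))]
    _ = ∑ m ∈ box d (4 * L), quadCount (box d L) m * f m := by
        refine Finset.sum_congr rfl fun m _ => ?_
        rw [quadCount, Finset.sum_mul]
        refine Finset.sum_congr rfl fun u _ => ?_
        rw [Finset.sum_mul]
        refine Finset.sum_congr rfl fun v _ => ?_
        rw [Finset.sum_mul]
        refine Finset.sum_congr rfl fun u' _ => ?_
        rw [Finset.sum_mul]

/-- The fourfold count of `Λ_L` vanishes off `Λ_{4L}`. [folklore] -/
theorem quadCount_box_eq_zero {L : ℕ} {m : Site d} (hm : m ∉ box d (4 * L)) : quadCount (box d L) m = 0 := by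
  rw [quadCount]
  refine Finset.sum_eq_zero fun u hu => Finset.sum_eq_zero fun v hv => Finset.sum_eq_zero fun u' hu' =>
    Finset.sum_eq_zero fun v' hv' => ?_
  rw [if_neg]
  intro h
  exact hm (h ▸ quad_mem_box hu hv hu' hv')

/-- **The normalised fourfold free sums converge to the Fourier transform of the two-point function**
(when `x ↦ S_β(x)cos(p·x)` is summable): with `c_L = c_{Λ_L}`,
`c_L(0)⁻¹ ∑_{Λ_L⁴} cos(p·m) S_β(m) = ∑_m (c_L(m)/c_L(0)) S_β(m)cos(p·m) → ∑_m S_β(m)cos(p·m)`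
(dominated convergence: the weights are in `[0, 27^d]` and tend to `1`).
[cite: Panis2023Triviality, §3.3 (definition of Ŝ_{ρ,β})] -/
theorem tendsto_fourfoldFree_div (J : Site d → Site d → ℝ) (β : ℝ) (p : Fin d → ℝ)
    (hsum : Summable fun x : Site d => pairCorrelation J β 0 x * Real.cos (phase p x)) :
    Tendsto (fun L : ℕ => (∑ u ∈ box d L, ∑ v ∈ box d L, ∑ u' ∈ box d L, ∑ v' ∈ box d L,
        Real.cos (phase p (u - v - u' + v')) * pairCorrelation J β 0 (u - v - u' + v')) / quadCount (box d L) 0) atTop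
      (𝓝 (twoPointFourier J β p)) := by
  set a : Site d → ℝ := fun m => pairCorrelation J β 0 m * Real.cos (phase p m) with ha
  set w : ℕ → Site d → ℝ := fun L m => quadCount (box d L) m / quadCount (box d L) 0 * a m with hw
  -- the normalised fourfold sum is the `tsum` of `w L`
  have hrep : ∀ L : ℕ, (∑ u ∈ box d L, ∑ v ∈ box d L, ∑ u' ∈ box d L, ∑ v' ∈ box d L,
      Real.cos (phase p (u - v - u' + v')) * pairCorrelation J β 0 (u - v - u' + v')) / quadCount (box d L) 0 =
      ∑' m, w L m := by
    intro L
    rw [fourfold_eq_sum_quadCount L (fun m => Real.cos (phase p m) * pairCorrelation J β 0 m), Finset.sum_div]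
    rw [tsum_eq_sum (s := box d (4 * L)) (fun m hm => by rw [hw]; simp only; rw [quadCount_box_eq_zero hm]; simp)]
    refine Finset.sum_congr rfl fun m _ => ?_
    simp only [hw, ha]
    ring
  simp_rw [hrep]
  rw [twoPointFourier]
  -- dominated convergence
  refine tendsto_tsum_of_dominated_convergence (bound := fun m => (27 : ℝ) ^ d * ‖a m‖) (hsum.norm.mul_left _)
    (fun m => ?_) ?_
  · have h := (tendsto_quadCount_box_div (d := d) m).mul_const (a m)
    rw [one_mul] at h
    exact h
  · filter_upwards [eventually_ge_atTop 1] with L hL m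
    rw [hw]
    simp only
    rw [norm_mul, Real.norm_eq_abs, abs_of_nonneg (div_nonneg (quadCount_nonneg _ _) (quadCount_nonneg _ _))]
    exact mul_le_mul_of_nonneg_right (quadCount_box_div_le hL m) (norm_nonneg _)

/-- **The error terms vanish as `L → ∞`**: if `0 ≤ T_L ≤ D L^e` (`L ≥ 1`) with `e < 3`, then
`(A ((2L+1)^{d-1})³ + C ((2L+1)^{d-1})³ T_L)/c_{Λ_L}(0) → 0` (`c_{Λ_L}(0) ≥ L^{3d}`). [folklore] -/
theorem tendsto_error_div_quadCount (hd : 1 ≤ d) {A C D e : ℝ} (hA : 0 ≤ A) (hC : 0 ≤ C) (hD : 0 ≤ D) (he0 : 0 ≤ e)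
    (he : e < 3) {T : ℕ → ℝ} (hT0 : ∀ L, 1 ≤ L → 0 ≤ T L) (hT : ∀ L : ℕ, 1 ≤ L → T L ≤ D * (L : ℝ) ^ e) :
    Tendsto (fun L : ℕ => (A * ((2 * L + 1 : ℝ) ^ (d - 1)) ^ 3 + C * (((2 * L + 1 : ℝ) ^ (d - 1)) ^ 3 * T L)) /
      quadCount (box d L) 0) atTop (𝓝 0) := by
  set K : ℝ := (3 : ℝ) ^ (3 * (d - 1)) * (A + C * D) with hK
  -- the comparison sequence `K L^{e-3} → 0`
  have hlim : Tendsto (fun L : ℕ => K * (L : ℝ) ^ (e - 3)) atTop (𝓝 0) := by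
    have h1 : Tendsto (fun L : ℕ => (L : ℝ) ^ (e - 3)) atTop (𝓝 0) := by
      have := (tendsto_rpow_neg_atTop (by linarith : 0 < 3 - e)).comp tendsto_natCast_atTop_atTop
      refine this.congr fun L => ?_
      simp only [Function.comp_apply]
      rw [show e - 3 = -(3 - e) by ring]
    simpa using h1.const_mul K
  refine tendsto_of_tendsto_of_tendsto_of_le_of_le' tendsto_const_nhds hlim ?_ ?_
  · filter_upwards [eventually_ge_atTop 1] with L hL
    exact div_nonneg (add_nonneg (by positivity) (mul_nonneg hC (mul_nonneg (by positivity) (hT0 L hL))))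
      (quadCount_nonneg _ _)
  · filter_upwards [eventually_ge_atTop 1] with L hL
    have hL1 : (1 : ℝ) ≤ L := by exact_mod_cast hL
    have hL0 : (0 : ℝ) < L := by linarith
    have hq : ((L : ℝ) ^ 3) ^ d ≤ quadCount (box d L) 0 := pow_le_quadCount_box L
    have hqpos : 0 < quadCount (box d L) 0 := lt_of_lt_of_le (by positivity) hq
    -- `((2L+1)^{d-1})³ ≤ 3^{3(d-1)} L^{3(d-1)}`
    have hs : ((2 * L + 1 : ℝ) ^ (d - 1)) ^ 3 ≤ (3 : ℝ) ^ (3 * (d - 1)) * (L : ℝ) ^ (3 * (d - 1)) := by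
      rw [← pow_mul, mul_comm (d - 1) 3, ← mul_pow]
      exact pow_le_pow_left₀ (by positivity) (by linarith) _
    -- `L^{3(d-1)} / L^{3d} = L^{-3} ≤ L^{e-3}`
    have hpow : (L : ℝ) ^ (3 * (d - 1)) / ((L : ℝ) ^ 3) ^ d ≤ (L : ℝ) ^ (e - 3) := by
      have e1 : ((L : ℝ) ^ 3) ^ d = (L : ℝ) ^ (3 * (d - 1)) * (L : ℝ) ^ 3 := by
        rw [← pow_mul, ← pow_add]
        congr 1
        omega
      rw [e1, div_mul_eq_div_div, div_self (by positivity), one_div]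
      rw [show ((L : ℝ) ^ 3)⁻¹ = (L : ℝ) ^ ((-3 : ℝ)) by
        rw [Real.rpow_neg hL0.le, ← Real.rpow_natCast]; norm_num]
      exact Real.rpow_le_rpow_of_exponent_le hL1 (by linarith)
    have hTe : T L ≤ D * (L : ℝ) ^ e := hT L hL
    have hTL : ((2 * L + 1 : ℝ) ^ (d - 1)) ^ 3 * T L / quadCount (box d L) 0 ≤
        (3 : ℝ) ^ (3 * (d - 1)) * D * (L : ℝ) ^ (e - 3) := by
      calc ((2 * L + 1 : ℝ) ^ (d - 1)) ^ 3 * T L / quadCount (box d L) 0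
          ≤ ((3 : ℝ) ^ (3 * (d - 1)) * (L : ℝ) ^ (3 * (d - 1))) * (D * (L : ℝ) ^ e) / ((L : ℝ) ^ 3) ^ d := by
            refine div_le_div₀ (by positivity) (mul_le_mul hs hTe (hT0 L hL) (by positivity)) (by positivity) hq
        _ = (3 : ℝ) ^ (3 * (d - 1)) * D * ((L : ℝ) ^ e * ((L : ℝ) ^ (3 * (d - 1)) / ((L : ℝ) ^ 3) ^ d)) := by ring
        _ ≤ (3 : ℝ) ^ (3 * (d - 1)) * D * ((L : ℝ) ^ e * (L : ℝ) ^ ((-3 : ℝ))) := by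
            have h3 : (L : ℝ) ^ (3 * (d - 1)) / ((L : ℝ) ^ 3) ^ d ≤ (L : ℝ) ^ ((-3 : ℝ)) := by
              have := hpow
              have e2 : (L : ℝ) ^ (3 * (d - 1)) / ((L : ℝ) ^ 3) ^ d = (L : ℝ) ^ ((-3 : ℝ)) := by
                have e1 : ((L : ℝ) ^ 3) ^ d = (L : ℝ) ^ (3 * (d - 1)) * (L : ℝ) ^ 3 := by
                  rw [← pow_mul, ← pow_add]; congr 1; omega
                rw [e1, div_mul_eq_div_div, div_self (by positivity), one_div, Real.rpow_neg hL0.le, ← Real.rpow_natCast]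
                norm_num
              exact e2.le
            gcongr
        _ = (3 : ℝ) ^ (3 * (d - 1)) * D * (L : ℝ) ^ (e - 3) := by
            rw [← Real.rpow_add hL0]; ring_nf
    have hAL : A * ((2 * L + 1 : ℝ) ^ (d - 1)) ^ 3 / quadCount (box d L) 0 ≤ (3 : ℝ) ^ (3 * (d - 1)) * A * (L : ℝ) ^ (e - 3) := by
      calc A * ((2 * L + 1 : ℝ) ^ (d - 1)) ^ 3 / quadCount (box d L) 0
          ≤ A * ((3 : ℝ) ^ (3 * (d - 1)) * (L : ℝ) ^ (3 * (d - 1))) / ((L : ℝ) ^ 3) ^ d :=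
            div_le_div₀ (by positivity) (mul_le_mul_of_nonneg_left hs hA) (by positivity) hq
        _ = (3 : ℝ) ^ (3 * (d - 1)) * A * ((L : ℝ) ^ (3 * (d - 1)) / ((L : ℝ) ^ 3) ^ d) := by ring
        _ ≤ (3 : ℝ) ^ (3 * (d - 1)) * A * (L : ℝ) ^ (e - 3) := by gcongr
    rw [add_div, hK]
    have : C * (((2 * L + 1 : ℝ) ^ (d - 1)) ^ 3 * T L) / quadCount (box d L) 0 ≤ C * ((3 : ℝ) ^ (3 * (d - 1)) * D * (L : ℝ) ^ (e - 3)) := by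
      rw [mul_div_assoc]
      exact mul_le_mul_of_nonneg_left hTL hC
    nlinarith [this, hAL]

end LLimit

/-! ### Assembly: Proposition 3.7 with the Fröhlich–Simon–Spencer constant -/

section Assembly

variable {C₀ α : ℝ}

/-- **The single box sums along the even tori, uniformly packaged**: there are `T_L ≥ 0`, `D ≥ 0` and an
exponent `0 ≤ e < 3` with `T_L ≤ D L^e` such that for every `L ≥ 1` and `ε' > 0`,
`∑_{m∈Λ_{4L}} G_{2M+2}(m̄) ≤ T_L + ε'` for all large `M` (`d ≤ 2`: the trivial bound `|Λ_{4L}|`, `e = d`;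
`d ≥ 3`: the torus infrared bound in `x`-space and the vanishing of the zero mode below `β_c`, `e = α∧2`).
[cite: Panis2023Triviality, proof of Proposition 3.8 and Remark 3.9] -/
theorem exists_singleBoxSum_package (hd : 1 ≤ d) (hC₀ : 0 < C₀) (hα : 0 < α) {β : ℝ} (hβ : 0 < β)
    (hβc : β < LongRangeIsing.criticalBeta (algebraicCoupling d C₀ α)) :
    ∃ (T : ℕ → ℝ) (D e : ℝ), (∀ L : ℕ, 1 ≤ L → 0 ≤ T L) ∧ 0 ≤ D ∧ 0 ≤ e ∧ e < 3 ∧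
      (∀ L : ℕ, 1 ≤ L → T L ≤ D * (L : ℝ) ^ e) ∧
      (∀ L : ℕ, 1 ≤ L → ∀ ε' : ℝ, 0 < ε' → ∀ᶠ M : ℕ in atTop,
        ∑ m ∈ box d (4 * L), torusExpect (torusCoupling (algebraicCoupling d C₀ α) (2 * M + 1 + 1)) β 0
          (fun σ => spinAt 0 σ * spinAt (Torus.proj (2 * M + 1 + 1) m) σ) ≤ T L + ε') := by
  set J := algebraicCoupling d C₀ α with hJ
  rcases lt_or_ge d 3 with hd3 | hd3
  · ------------------------------------------------------------ `d ≤ 2`: the trivial bound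
    refine ⟨fun L => (#(box d (4 * L)) : ℝ), (9 : ℝ) ^ d, d, fun L _ => by positivity, by positivity,
      by positivity, by exact_mod_cast hd3, fun L hL => ?_, fun L _ ε' hε' => Eventually.of_forall fun M => ?_⟩
    · dsimp only
      rw [card_box, Real.rpow_natCast]
      push_cast
      rw [← mul_pow]
      exact pow_le_pow_left₀ (by positivity) (by have h1 : (1 : ℝ) ≤ L := (by exact_mod_cast hL); linarith) d
    · exact (sum_box_torusPair_le_card (N := 2 * M + 1 + 1) (4 * L)).trans (le_add_of_nonneg_right hε'.le)
  · ------------------------------------------------------------ `d ≥ 3`: the torus infrared bound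
    -- a cube gap bound with exponent `α ∧ 2`
    obtain ⟨c', hc', hglob⟩ : ∃ c' : ℝ, 0 < c' ∧ ∀ q : Fin d → ℝ, ‖q‖ ≤ Real.pi →
        c' * ‖q‖ ^ min α 2 ≤ 1 - couplingFourier J q := by
      rcases lt_or_ge α 2 with hα2 | hα2
      · exact exists_cube_gap_lower hd hC₀ hα hα2.ne
      · obtain ⟨c₁, hc₁, h⟩ := sq_le_one_sub_couplingFourier_algebraic hd hC₀ hα
        refine ⟨c₁, hc₁, fun q hq => ?_⟩
        rw [min_eq_right hα2, Real.rpow_two]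
        exact h q hq
    set a : ℝ := min α 2 with ha
    have ha0 : 0 < a := lt_min hα two_pos
    have ha2 : a ≤ 2 := min_le_right α 2
    have hd3' : (3 : ℝ) ≤ d := by exact_mod_cast hd3
    have had : 0 < 1 - a / d := by
      rw [sub_pos, div_lt_one (by linarith)]
      linarith
    have hpos := couplingNorm_algebraic_pos hd hC₀ hα
    set CK : ℝ := (9 * Real.pi ^ 2) ^ d * (394 + 2 / (1 - a / d)) ^ d / (couplingNorm J * c') with hCK
    have hCK0 : 0 ≤ CK := by positivity
    set T : ℕ → ℝ := fun L => CK * ((2 * (4 * L) : ℕ) : ℝ) ^ ((d : ℝ) + a) / β / #(box d (4 * L)) with hT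
    have hT0 : ∀ L : ℕ, 1 ≤ L → 0 ≤ T L := fun L _ => by positivity
    -- zero-field facts for the zero mode
    have hJnn : ∀ x y, 0 ≤ J x y := algebraicCoupling_nonneg hC₀.le α
    have hJt : ∀ a x y, J (x + a) (y + a) = J x y := algebraicCoupling_add C₀ α
    have hJs : Summable (J 0) := algebraicCoupling_zero_summable hd hC₀.le hα
    have hm := magnetization_eq_zero_of_lt_criticalBeta J β hβ hβc hJnn
    refine ⟨T, CK * (8 : ℝ) ^ a / β, a, hT0, by positivity, ha0.le, by linarith, fun L hL => ?_, fun L hL ε' hε' => ?_⟩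
    · -- `T_L ≤ CK 8^a L^a / β`
      have hL0 : (0 : ℝ) < L := by exact_mod_cast hL
      have h8L : (0 : ℝ) < 8 * L := by positivity
      have hcard : ((8 : ℝ) * L) ^ d ≤ #(box d (4 * L)) := by
        rw [card_box]; push_cast
        exact pow_le_pow_left₀ h8L.le (by linarith) d
      have hcard0 : (0 : ℝ) < #(box d (4 * L)) := lt_of_lt_of_le (by positivity) hcard
      have hsplit : ((2 * (4 * L) : ℕ) : ℝ) ^ ((d : ℝ) + a) = ((8 : ℝ) * L) ^ d * ((8 : ℝ) ^ a * (L : ℝ) ^ a) := by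
        have e8 : ((2 * (4 * L) : ℕ) : ℝ) = 8 * L := by push_cast; ring
        rw [e8, Real.rpow_add h8L, Real.rpow_natCast, Real.mul_rpow (by norm_num) hL0.le]
      rw [hT]
      simp only
      rw [hsplit]
      rw [div_div, div_le_iff₀ (by positivity)]
      calc CK * (((8 : ℝ) * L) ^ d * ((8 : ℝ) ^ a * (L : ℝ) ^ a))
          = CK * (8 : ℝ) ^ a / β * (L : ℝ) ^ a * (β * ((8 : ℝ) * L) ^ d) := by field_simp
        _ ≤ CK * (8 : ℝ) ^ a / β * (L : ℝ) ^ a * (β * #(box d (4 * L))) := by gcongr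
    · -- the zero mode and the torus infrared bound
      set cL : ℝ := ((((2 * (2 * (4 * L)) + 1 : ℕ) : ℝ) ^ d) ^ 2) with hcL
      have hcL0 : 0 < cL := by positivity
      have hcard0 : (0 : ℝ) < #(box d (4 * L)) := by exact_mod_cast Finset.card_pos.2 (box_nonempty d (4 * L))
      obtain ⟨N₀, hN₀⟩ := torus_zeroMode_le_eventually J β hd hβ hJnn hJt hJs hm
        (show 0 < ε' * #(box d (4 * L)) / cL by positivity)
      filter_upwards [eventually_ge_atTop (max N₀ (112 * L))] with M hM
      have hMN₀ : N₀ ≤ 2 * M + 1 + 1 := by omega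
      have hML : 112 * L ≤ 2 * M + 1 + 1 := by omega
      have hNe : Even (2 * M + 1 + 1) := ⟨M + 1, by ring⟩
      have hz := hN₀ (2 * M + 1 + 1) hMN₀
      have hb := card_mul_sum_box_torusPair_le (N := 2 * M + 1 + 1) hd3 hC₀ hα hc' hglob hNe hL hML hβ
      set N : ℕ := 2 * M + 1 + 1 with hN
      have hNd : (0 : ℝ) < (N : ℝ) ^ d := by positivity
      have hz' : ((N : ℝ) ^ d)⁻¹ * (∑ z, torusExpect (torusCoupling J N) β 0 (fun σ => spinAt 0 σ * spinAt z σ)) * cL ≤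
          ε' * #(box d (4 * L)) := by
        calc ((N : ℝ) ^ d)⁻¹ * (∑ z, torusExpect (torusCoupling J N) β 0 (fun σ => spinAt 0 σ * spinAt z σ)) * cL
            ≤ ((N : ℝ) ^ d)⁻¹ * (ε' * #(box d (4 * L)) / cL * (N : ℝ) ^ d) * cL := by gcongr
          _ = ε' * #(box d (4 * L)) := by field_simp
      have hb' : (#(box d (4 * L)) : ℝ) * ∑ m ∈ box d (4 * L), torusExpect (torusCoupling J N) β 0
          (fun σ => spinAt 0 σ * spinAt (Torus.proj N m) σ) ≤ #(box d (4 * L)) * (T L + ε') := by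
        refine hb.trans ?_
        rw [hT]
        simp only
        rw [mul_add, mul_div_cancel₀ _ hcard0.ne']
        linarith
      exact le_of_mul_le_mul_left hb' hcard0

end Assembly

end LongRangeIsing

open LongRangeIsing

/-- **DISCHARGE of `panis_prop37_infraredBound_fss` — Panis 2023, Proposition 3.7 with the
Fröhlich–Simon–Spencer constant, for `J_{x,y} = C₀|x-y|₁^{-d-α}`**: for `d ≥ 1`, `C₀, α > 0`,
`0 < β < β_c`, `p ∈ (-π,π]^d ∖ {0}`, `Ŝ_β(p) = ∑_x S_β(x)cos(p·x) ≤ 1/(β|J|(1-Ĵ(p)))`.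
Proof: if `x ↦ S_β(x)cos(p·x)` is not summable the `tsum` vanishes. Otherwise test the torus two-point
function of `𝕋_N` against the modulated Jackson window `f = g_L e^{-ip·}`, `g_L = 𝟙_{Λ_L} ⋆ 𝟙_{Λ_L}`
(fourfold Parseval); bound the Fourier side by the three-region estimate `fourierSide_le` (the torus
infrared bound Proposition 3.4 off the near region, positivity of `Ŝ_N` and the slab identity on the
small cube, the `x`-space torus bound / zero mode for the single box sum); let `N → ∞` along the even tori
with the convergence `⟨σ₀σ_z̄⟩_{𝕋_N} → S_β(z)` of `…TorusLimit` (`m*(β) = 0` below `β_c`); normalise by the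
fourfold count `c_{Λ_L}(0)` and let `L → ∞` (dominated convergence), then let the near-width `δ → 0`
(continuity of `Ĵ` at `p`). [cite: Panis2023Triviality, Proposition 3.7] [cite: FriedliVelenik2017, Thm. 10.24 with (10.38)] -/
theorem panis_prop37_infraredBound_fss_holds : panis_prop37_infraredBound_fss := by
  intro d hd C₀ α hC₀ hα β hβ hβc p hp hp0
  set J := algebraicCoupling d C₀ α with hJ
  have hpos := couplingNorm_algebraic_pos hd hC₀ hα
  have hJ0 : ∀ x, 0 ≤ J 0 x := fun x => algebraicCoupling_nonneg hC₀.le α 0 x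
  have hs := algebraicCoupling_zero_summable hd hC₀.le hα
  have hpπ : ‖p‖ ≤ Real.pi := norm_le_pi_of_mem_momentumBox_one hp
  have hpi : ∀ i, |p i| ≤ Real.pi := fun i => le_trans (by rw [← Real.norm_eq_abs]; exact norm_le_pi_norm p i) hpπ
  obtain ⟨c₁, hc₁, hgap⟩ := sq_le_one_sub_couplingFourier_algebraic hd hC₀ hα
  have hpn : 0 < ‖p‖ := norm_pos_iff.2 hp0
  have hgapp : 0 < 1 - couplingFourier J p := lt_of_lt_of_le (by positivity) (hgap p hpπ)
  rw [show β * couplingNorm J * (1 - couplingFourier J p) = β * (couplingNorm J * (1 - couplingFourier J p)) by ring]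
  set Bp : ℝ := 1 / (β * (couplingNorm J * (1 - couplingFourier J p))) with hBp
  have hBp0 : 0 ≤ Bp := by positivity
  ------------------------------------------------------------------ the non-summable case
  by_cases hsum : Summable fun x : Site d => pairCorrelation J β 0 x * Real.cos (phase p x)
  swap
  · rw [twoPointFourier, tsum_eq_zero_of_not_summable hsum]
    exact hBp0
  ------------------------------------------------------------------ the summable case
  refine le_of_forall_pos_le_add fun ε hε => ?_
  -- a direction with `|p_{i₀}| = ‖p‖ > 0`
  obtain ⟨i₀, hi₀⟩ := exists_abs_eq_norm hd p
  have hp0' : 0 < |p i₀| := by rw [hi₀]; exact hpn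
  -- continuity of `Ĵ` at `p`: the near-width `δ`
  obtain ⟨δ, hδ, hδp, hcont⟩ : ∃ δ : ℝ, 0 < δ ∧ δ ≤ |p i₀| / 2 ∧ ∀ η : Fin d → ℝ, (∀ i, |η i| < δ) →
      0 < 1 - couplingFourier J (p + η) ∧
        1 / (β * (couplingNorm J * (1 - couplingFourier J (p + η)))) ≤ Bp + ε / 2 := by
    have hcJ : Continuous (couplingFourier J) := continuous_couplingFourier J hJ0 hs
    have hcB : ContinuousAt (fun q => 1 / (β * (couplingNorm J * (1 - couplingFourier J q)))) p :=
      continuousAt_const.div (continuousAt_const.mul (continuousAt_const.mul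
        (continuousAt_const.sub hcJ.continuousAt))) (by positivity)
    obtain ⟨δ₁, hδ₁, h₁⟩ := (Metric.continuousAt_iff.1 hcJ.continuousAt) ((1 - couplingFourier J p) / 2) (by positivity)
    obtain ⟨δ₂, hδ₂, h₂⟩ := (Metric.continuousAt_iff.1 hcB) (ε / 2) (by positivity)
    refine ⟨min (min δ₁ δ₂) (|p i₀| / 2), by positivity, min_le_right _ _, fun η hη => ?_⟩
    have hηn : ‖η‖ < min (min δ₁ δ₂) (|p i₀| / 2) :=
      (pi_norm_lt_iff (by positivity)).2 fun i => by rw [Real.norm_eq_abs]; exact hη i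
    have hdist : dist (p + η) p = ‖η‖ := by rw [dist_eq_norm, add_sub_cancel_left]
    have hd₁ : dist (p + η) p < δ₁ := by
      rw [hdist]; exact lt_of_lt_of_le hηn ((min_le_left _ _).trans (min_le_left _ _))
    have hd₂ : dist (p + η) p < δ₂ := by
      rw [hdist]; exact lt_of_lt_of_le hηn ((min_le_left _ _).trans (min_le_right _ _))
    have hc₁' := h₁ hd₁
    have hc₂' := h₂ hd₂
    rw [Real.dist_eq, abs_lt] at hc₁' hc₂'
    exact ⟨by linarith [hc₁'.1, hc₁'.2], by linarith [hc₂'.1, hc₂'.2]⟩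
  have hBω : 0 ≤ Bp + ε / 2 := by positivity
  ------------------------------------------------------------------ the single box sums
  obtain ⟨T, D, e, hT0, hD, he0, he3, hTD, hSbT⟩ := exists_singleBoxSum_package hd hC₀ hα hβ hβc
  ------------------------------------------------------------------ constants
  set s : ℕ → ℝ := fun L => ((2 * L + 1 : ℝ) ^ (d - 1)) ^ 3 with hsdef
  set A : ℝ := 1 / (β * (couplingNorm J * (c₁ * (|p i₀| / 2) ^ 2))) * (1 / Real.sin (δ / 2)) ^ 4 * d with hA
  set C' : ℝ := (1 / Real.sin (|p i₀| / 4)) ^ 4 with hC'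
  have hπ := Real.pi_pos
  have hsδ : 0 < Real.sin (δ / 2) := Real.sin_pos_of_pos_of_lt_pi (by linarith) (by linarith [hpi i₀])
  have hsp : 0 < Real.sin (|p i₀| / 4) := Real.sin_pos_of_pos_of_lt_pi (by linarith) (by linarith [hpi i₀])
  have hA0 : 0 ≤ A := by positivity
  have hC'0 : 0 ≤ C' := by positivity
  ------------------------------------------------------------------ for every `L ≥ 1`
  set Qf : ℕ → ℝ := fun L => ∑ u ∈ box d L, ∑ v ∈ box d L, ∑ u' ∈ box d L, ∑ v' ∈ box d L,
    Real.cos (phase p (u - v - u' + v')) * pairCorrelation J β 0 (u - v - u' + v') with hQf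
  set E : ℕ → ℝ := fun L => (A * s L + C' * (s L * T L)) / quadCount (box d L) 0 with hE
  have hdivL : ∀ L : ℕ, 1 ≤ L → Qf L / quadCount (box d L) 0 ≤ Bp + ε / 2 + E L := by
    intro L hL
    have hF6 := fourfoldFree_le hd hC₀ hα hβ hβc L hpi hp0' hδ hδp hBω hcont hc₁ hgap (hSbT L hL)
    have hq : ((L : ℝ) ^ 3) ^ d ≤ quadCount (box d L) 0 := pow_le_quadCount_box L
    have hL0 : (0 : ℝ) < L := by exact_mod_cast hL
    have hqpos : 0 < quadCount (box d L) 0 := lt_of_lt_of_le (by positivity) hq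
    have e : (Bp + ε / 2) * quadCount (box d L) 0 + (A * s L + C' * (s L * T L)) =
        (Bp + ε / 2) * quadCount (box d L) 0 +
        1 / (β * (couplingNorm J * (c₁ * (|p i₀| / 2) ^ 2))) * (1 / Real.sin (δ / 2)) ^ 4 *
          (d * ((2 * L + 1 : ℝ) ^ (d - 1)) ^ 3) +
        (1 / Real.sin (|p i₀| / 4)) ^ 4 * (((2 * L + 1 : ℝ) ^ (d - 1)) ^ 3 * T L) := by
      simp only [hA, hsdef, hC']
      ring
    simp only [hE, hQf]
    rw [div_le_iff₀ hqpos, add_mul, div_mul_cancel₀ _ hqpos.ne']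
    linarith [hF6, e]
  ------------------------------------------------------------------ the limits `L → ∞`
  have hE0 : Tendsto E atTop (𝓝 0) := by
    have h := tendsto_error_div_quadCount hd hA0 hC'0 hD he0 he3 hT0 hTD
    simp only [hE, hsdef]
    exact h
  have hlhs : Tendsto (fun L => Qf L / quadCount (box d L) 0) atTop (𝓝 (twoPointFourier J β p)) := by
    simp only [hQf]
    exact tendsto_fourfoldFree_div J β p hsum
  have hrhs : Tendsto (fun L => Bp + ε / 2 + E L) atTop (𝓝 (Bp + ε / 2)) := by
    simpa using tendsto_const_nhds.add hE0
  have hle : twoPointFourier J β p ≤ Bp + ε / 2 :=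
    le_of_tendsto_of_tendsto hlhs hrhs (by
      filter_upwards [eventually_ge_atTop 1] with L hL
      exact hdivL L hL)
  linarith


end Literature.Barriers.CriticalPhenomena
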